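import Literature.Probability.RandomPlanarGeometry.SAWTriangularStripCuts
import Literature.Probability.RandomPlanarGeometry.HexSAWBrickWallStripInsertion
import HarnessLib

/-!
# The four-column slab insertion on triangular strips (the injection behind `μ(S_T(𝕋)) < μ(S_{T+1}(𝕋))`)

Topic `Literature/Probability/RandomPlanarGeometry` (continues `SAWTriangularStripCuts.lean` — slanted columns
`colIdx`, the admissible cuts `TriStrip.triCuts a υ n` of a walk of the triangular strip `S_T = {0 ≤ Y ≤ T}` (brick
coordinates), `n/(T+1) ≤ #triCuts + 3` — and feeds `SAWTriangularStripInsertionCore.lean`: ANY insertion `Ψ` with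
per-cut cost `≤ 4T+6` mapping (walk of `S_T`, subset of its admissible cuts) injectively to walks of `S_{T+1}` of
length `n + Σ cost` proves `μ(S_T) < μ(S_{T+1})` with margin).  Source of the STATEMENT: N. Madras, G. Slade, *The
Self-Avoiding Walk* (1993), §8.2, Theorem 8.2.1, eq. (8.2.13), p. 269 ("`μ(R[k,T]) < μ(R[k,T+1])`", tubes of `ℤ^d`,
proved there by bridge renewal, p. 270 — not the proof formalised).  The proof here is the lane's INJECTIVE MULTI-SLAB
INSERTION (door «TRI-STRIP-STRICT»; design a-idea-1 gen 17 `Sketch_G17_R98` — slanted columns, ladder steps, one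
four-column slab per cut, straight bridges on the crossing rows and a detour of the topmost crossing to the new row
`T + 1` —, with the a-p5 gen 8 TIME-LOCAL side rule; the column bookkeeping `colMap`/`ofList` is the tree's
`HexBW.StripInsertion` of `HexSAWBrickWallStripInsertion.lean`, lattice-free and reused by name).

## The insertion (all PROVED; namespace `Literature.Probability.RandomPlanarGeometry.SAW.TriStrip`, machinery in `TriStrip.StripInsertion`)

In the slanted coordinates `(i, Y)`, `i = ⌊(X − Y)/2⌋`, the triangular lattice is the square lattice plus the
antidiagonals `±(1, −1)`.  Fix a walk `ω` of `S_T` and a set `R` of admissible cuts.  For a cut `c` call a step a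
LADDER step if it joins the columns `c` and `c + 1`; a site is INTERIOR (for `c`) if both its steps are ladder steps;
a site is RIGHT (for `c`) if its column is `≥ c + 2`, or `= c + 1` and it is not interior.  A step is a CROSSING of
`c` if exactly one of its ends is RIGHT; then (`cross_spec`) it is a ladder step whose column-`(c+1)` end `v` is
RIGHT, distinct crossings have ends `v` in distinct rows (`crossTimes_row_inj`), so there are at most `T + 1` of them.
The image: every site moves `4` columns to the right for each cut of `R` it is RIGHT of (column map `σ` of
`HexBW.StripInsertion.colMap`, four fresh columns `σ c + 1 … σ c + 4` after each `c ∈ R`; interior sites of column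
`c + 1` stay at `σ c + 1`); after each crossing of `c ∈ R` with end `v = (c+1, Y_v)` the four cells
`(σ c + 1 … σ c + 4, Y_v)` are inserted (the first is `v`'s vacated cell), except for the TOPMOST crossing of the
cut, which makes the detour `(σ c + 1, Y*) → (σ c + 2, Y* … T+1) → (σ c + 3, T+1 … Y*) → (σ c + 4, Y*)`.  The image is
a self-avoiding walk of `S_{T+1}` (`nodup_imageList`, `isChain_imageList`) of length `n + Σ_{c ∈ R} cost(c)`,
`cost(c) ≤ 4T + 6` (`cost_le`), and `(ω, R) ↦ Ψ(ω, R)` is injective (`psi_inj`): the cells of row `T + 1` are exactly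
`(σ c + 2, T+1), (σ c + 3, T+1)`, `c ∈ R`, which returns `σ` and `R`; the image points `z` not in a column
`σ c + 2 … σ c + 4` and not of the form (column `σ c + 1`, with `z + (8,0)` also in the image) are exactly the moved
sites of `ω`, in order, which returns `ω`.

Evidence outside the kernel (lane «pcv-sawmu», a-p5 gen 8 `simul_check.py`): the same definitions with the same
decoder pass on all (walk, cut-set) pairs with `T = 1, n ≤ 10`, `T = 2, n ≤ 8`, `T = 3, n ≤ 8`, `T = 4, n ≤ 7`
(≈ 2.8 · 10⁶ pairs).

## Main statements

* `TriStrip.stripInsertion`, `TriStrip.stripInsertionCost`, `TriStrip.stripInsertionCost_le` (**hcost**, `≤ 4T+6`),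
  `TriStrip.stripInsertion_mem` (**hmem**), `TriStrip.stripInsertion_injOn` (**hinj**).

## Label (lane «pcv-sawmu», lit-2 gen 15 cell of 2026-08-23)

The strict inequality `μ(S_T(𝕋)) < μ(S_{T+1}(𝕋))` served by this file is NEW-IN-WRITING for the triangular lattice, of
a classical type, by a NEW proof route (injective slab insertion, not the printed renewal / transfer-matrix arguments):
strict monotonicity of strip connective constants is printed for `ℤ^d` [cite: MadrasSlade1993, Theorem 8.2.1 (8.2.13), p. 269 and proof p. 270 (ℤ^d tubes; statement shape — the triangular-strip analogue is not printed there)]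
(Hammersley–Whittington 1985, Notes §8.5 p. 278; for `ℤ²` strips also Alm–Janson 1990 via Guttmann–Jensen LNP 775 p. 236)
and for the honeycomb lattice [cite: BeatonBousquetMelouDeGierDuminilCopinGuttmann2014, Proposition 7 (arXiv v5 p. 11: honeycomb strips, y > 0)];
for triangular strips we located no printed statement («𝕋-strip strict inequality: not located in print (lit-2 g15,
2026-08-23; Alm–Janson 1990 not held, acq-10417)»); the lane's proof is a direct injection rather than the printed
renewal argument.
-/

noncomputable section

open Finset Literature.Probability.LatticeModels Literature.Probability.Percolation SimpleGraph

namespace Literature.Probability.RandomPlanarGeometry.SAW.TriStrip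

open HexBW (InStrip stripStarts_mono)

namespace StripInsertion

open HexBW.StripInsertion (mk mk_zero mk_one mk_inj eq_mk colMap colMap_base colMap_succ colMap_succ_of_mem
  colMap_succ_of_not_mem colMap_lt_succ colMap_strictMono colMap_injective colMap_le_iff colMap_ne_ins ins_ne_ins
  colMap_not_ins ins_lt_ins ofList ofList_eq_getElem ofList_eq_getLast ofList_mem ofList_inj list_sum_map_range
  isChain_map_range)

/-! ### Slanted cells -/

/-- The brick site of the slanted cell `(i, Y)` on the coset with bit `r`: `X = 2 i + Y + r`.
[cite: Grimmett2018, §5.5 (brick coordinates of the triangular lattice)] -/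
def cellAt (r i Y : ℤ) : Site 2 := mk (2 * i + Y + r) Y

/-- The row of a cell. [cite: Grimmett2018, §5.5] -/
@[simp] theorem cellAt_one (r i Y : ℤ) : cellAt r i Y 1 = Y := rfl

/-- The abscissa of a cell. [cite: Grimmett2018, §5.5] -/
@[simp] theorem cellAt_zero (r i Y : ℤ) : cellAt r i Y 0 = 2 * i + Y + r := rfl

/-- The slanted column of a cell (bit `r ∈ {0,1}`). [cite: Grimmett2018, §5.5] -/
theorem colIdx_cellAt {r : ℤ} (hr : 0 ≤ r ∧ r ≤ 1) (i Y : ℤ) : colIdx (cellAt r i Y) = i := by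
  unfold colIdx; simp only [cellAt_zero, cellAt_one]; omega

/-- Cells are determined by their coordinates. [cite: Grimmett2018, §5.5] -/
theorem cellAt_inj {r i Y i' Y' : ℤ} : cellAt r i Y = cellAt r i' Y' ↔ i = i' ∧ Y = Y' := by
  unfold cellAt; rw [mk_inj]; omega

/-- A site is the cell of its slanted column and row. [cite: Grimmett2018, §5.5] -/
theorem eq_cellAt (u : Site 2) : u = cellAt (cosetBit u) (colIdx u) (u 1) := by
  have := apply_zero_eq u
  funext i; fin_cases i
  · show u 0 = cellAt (cosetBit u) (colIdx u) (u 1) 0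
    rw [cellAt_zero]; omega
  · rfl

/-- **Adjacency of cells in slanted coordinates**: the six steps `(±1,0)`, `(0,±1)`, `±(1,−1)`.
[cite: Grimmett2018, §5.5] -/
theorem adj_cellAt_iff {r i Y i' Y' : ℤ} :
    brickGraph.Adj (cellAt r i Y) (cellAt r i' Y') ↔
      (i' = i + 1 ∧ Y' = Y) ∨ (i = i' + 1 ∧ Y' = Y) ∨ (i' = i ∧ Y' = Y + 1) ∨ (i' = i ∧ Y = Y' + 1) ∨
        (i' = i + 1 ∧ Y = Y' + 1) ∨ (i = i' + 1 ∧ Y' = Y + 1) := by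
  rw [brickGraph_adj_iff]; simp only [cellAt_zero, cellAt_one]; omega

/-! ### The tall inserted columns determine the cut set (column map `σ = HexBW.StripInsertion.colMap`) -/

variable {x₀ : ℤ} {R : Finset ℤ}

/-- The TALL inserted columns of `R`: `σ c + 2, σ c + 3` for `c ∈ R` (the columns of the detour cells in the new top
row `T + 1`). [cite: MadrasSlade1993, §8.2, Theorem 8.2.1 (8.2.13), p. 269 (statement; slab insertion = the lane's proof)] -/
def tallIns (x₀ : ℤ) (R : Finset ℤ) : Finset ℤ :=
  R.biUnion fun c => {colMap x₀ R c + 2, colMap x₀ R c + 3}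

/-- Membership in `tallIns`. [cite: MadrasSlade1993, §8.2, Theorem 8.2.1 (8.2.13), p. 269] -/
theorem mem_tallIns {y : ℤ} : y ∈ tallIns x₀ R ↔ ∃ c ∈ R, y = colMap x₀ R c + 2 ∨ y = colMap x₀ R c + 3 := by
  simp [tallIns]

/-- `x ∈ R` iff `σ x + 2` is a tall inserted column. [cite: MadrasSlade1993, §8.2, Theorem 8.2.1 (8.2.13), p. 269] -/
theorem mem_iff_add_two_mem_tallIns (x : ℤ) : x ∈ R ↔ colMap x₀ R x + 2 ∈ tallIns x₀ R := by
  constructor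
  · intro hx; exact mem_tallIns.2 ⟨x, hx, Or.inl rfl⟩
  · intro h
    by_contra hx
    obtain ⟨c, hc, h⟩ := mem_tallIns.1 h
    have e := colMap_succ_of_not_mem (x₀ := x₀) hx
    rcases h with h | h
    · exact colMap_ne_ins (x₀ := x₀) hc (x + 1) (j := 1) (by norm_num) (by norm_num) (by omega)
    · exact colMap_ne_ins (x₀ := x₀) hc (x + 1) (j := 2) (by norm_num) (by norm_num) (by omega)

/-- `x ∈ R` iff `σ(x+1) − 2` is a tall inserted column. [cite: MadrasSlade1993, §8.2, Theorem 8.2.1 (8.2.13), p. 269] -/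
theorem mem_iff_sub_two_mem_tallIns (x : ℤ) : x ∈ R ↔ colMap x₀ R (x + 1) - 2 ∈ tallIns x₀ R := by
  constructor
  · intro hx
    rw [colMap_succ_of_mem hx]
    exact mem_tallIns.2 ⟨x, hx, Or.inr (by ring)⟩
  · intro h
    by_contra hx
    obtain ⟨c, hc, h⟩ := mem_tallIns.1 h
    have e := colMap_succ_of_not_mem (x₀ := x₀) hx
    rcases h with h | h
    · exact colMap_ne_ins (x₀ := x₀) hc x (j := 3) (by norm_num) (by norm_num) (by omega)
    · exact colMap_ne_ins (x₀ := x₀) hc x (j := 4) (by norm_num) (by norm_num) (by omega)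

/-- `σ` is determined by its set of tall inserted columns (induction up and down from the base column).
[cite: MadrasSlade1993, §8.2, Theorem 8.2.1 (8.2.13), p. 269] -/
theorem colMap_eq_of_tallIns_eq {R' : Finset ℤ} (h : tallIns x₀ R = tallIns x₀ R') (x : ℤ) :
    colMap x₀ R x = colMap x₀ R' x := by
  induction x using Int.inductionOn' with
  | b => exact x₀
  | zero => rw [colMap_base, colMap_base]
  | succ k _ ih =>
    have hm : k ∈ R ↔ k ∈ R' := by
      rw [mem_iff_add_two_mem_tallIns (x₀ := x₀) (R := R), mem_iff_add_two_mem_tallIns (x₀ := x₀) (R := R'),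
        ih, h]
    rw [colMap_succ, colMap_succ, ih]
    by_cases hk : k ∈ R
    · rw [if_pos hk, if_pos (hm.1 hk)]
    · rw [if_neg hk, if_neg (fun h' => hk (hm.2 h'))]
  | pred k _ ih =>
    have e1 := colMap_succ x₀ R (k - 1)
    have e2 := colMap_succ x₀ R' (k - 1)
    rw [sub_add_cancel] at e1 e2
    have hm : (k - 1) ∈ R ↔ (k - 1) ∈ R' := by
      rw [mem_iff_sub_two_mem_tallIns (x₀ := x₀) (R := R), mem_iff_sub_two_mem_tallIns (x₀ := x₀) (R := R'),
        sub_add_cancel, ih, h]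
    by_cases hk : (k - 1) ∈ R
    · rw [if_pos hk] at e1; rw [if_pos (hm.1 hk)] at e2; omega
    · rw [if_neg hk] at e1; rw [if_neg (fun h' => hk (hm.2 h'))] at e2; omega

/-- **Recovering `R`**: the set of tall inserted columns determines `R`. [cite: MadrasSlade1993, §8.2, Theorem 8.2.1 (8.2.13), p. 269] -/
theorem tallIns_injective {R' : Finset ℤ} (h : tallIns x₀ R = tallIns x₀ R') : R = R' := by
  ext x
  rw [mem_iff_add_two_mem_tallIns (x₀ := x₀) (R := R) x, mem_iff_add_two_mem_tallIns (x₀ := x₀) (R := R') x,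
    colMap_eq_of_tallIns_eq h x, h]

/-- `σ` as a count: `σ x = x + 4 (#{c ∈ R | c < x} − #{c ∈ R | c < x₀})`. [cite: MadrasSlade1993, §8.2, Theorem 8.2.1 (8.2.13), p. 269] -/
theorem colMap_eq_card (x₀ : ℤ) (R : Finset ℤ) (x : ℤ) :
    colMap x₀ R x = x + 4 * (((R.filter fun c => c < x).card : ℤ) - ((R.filter fun c => c < x₀).card : ℤ)) := by
  unfold colMap
  rw [Finset.sum_sub_distrib]
  simp only [Finset.sum_boole]

/-- The new column of a site of column `i` lies in `(σ(i−1), σ i]`; this interval determines `i`.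
[cite: MadrasSlade1993, §8.2, Theorem 8.2.1 (8.2.13), p. 269] -/
theorem eq_of_mem_Ioc {x i i' : ℤ} (h1 : colMap x₀ R (i - 1) < x) (h2 : x ≤ colMap x₀ R i)
    (h1' : colMap x₀ R (i' - 1) < x) (h2' : x ≤ colMap x₀ R i') : i = i' := by
  by_contra hne
  rcases lt_or_gt_of_ne hne with h | h
  · have : i ≤ i' - 1 := by omega
    have := (colMap_le_iff x₀ R).2 this
    omega
  · have : i' ≤ i - 1 := by omega
    have := (colMap_le_iff x₀ R).2 this
    omega

/-! ### The shape of the detour of the top crossing (indices `k < 2J + 6`, `J = T − row`) -/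

/-- Column offset (`1 … 4`, from `σ c`) of the `k`-th point of the detour with `J + 1` rows to climb:
`(1, 0)`, then `(2, 0 … J+1)` upwards, then `(3, J+1 … 0)` downwards, then `(4, 0)`.
[cite: MadrasSlade1993, §8.2, Theorem 8.2.1 (8.2.13), p. 269 (statement; slab insertion = the lane's proof)] -/
def dcol (J k : ℕ) : ℕ := if k = 0 then 1 else if k ≤ J + 2 then 2 else if k ≤ 2 * J + 4 then 3 else 4

/-- Row offset (`0 … J+1`, from the row of the crossing) of the `k`-th point of the detour.
[cite: MadrasSlade1993, §8.2, Theorem 8.2.1 (8.2.13), p. 269] -/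
def drow (J k : ℕ) : ℕ := if k = 0 then 0 else if k ≤ J + 2 then k - 1 else if k ≤ 2 * J + 4 then 2 * J + 4 - k else 0

/-- Ranges of the detour offsets. [cite: MadrasSlade1993, §8.2, Theorem 8.2.1 (8.2.13), p. 269] -/
theorem shape_range (J k : ℕ) : 1 ≤ dcol J k ∧ dcol J k ≤ 4 ∧ drow J k ≤ J + 1 := by
  unfold dcol drow; split_ifs <;> first | contradiction | omega

/-- The top row of the detour is met only in the columns `2, 3`. [cite: MadrasSlade1993, §8.2, Theorem 8.2.1 (8.2.13), p. 269] -/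
theorem shape_top {J k : ℕ} (h : drow J k = J + 1) : dcol J k = 2 ∨ dcol J k = 3 := by
  unfold dcol; unfold drow at h; split_ifs at h ⊢ <;> first | contradiction | omega

/-- The columns `1, 4` of the detour are met only in its bottom row. [cite: MadrasSlade1993, §8.2, Theorem 8.2.1 (8.2.13), p. 269] -/
theorem shape_ends {J k : ℕ} (h : dcol J k = 1 ∨ dcol J k = 4) : drow J k = 0 := by
  unfold drow; unfold dcol at h; split_ifs at h ⊢ <;> first | contradiction | omega

/-- Consecutive detour points are slanted neighbours (a horizontal or a vertical unit step).
[cite: MadrasSlade1993, §8.2, Theorem 8.2.1 (8.2.13), p. 269] -/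
theorem shape_step {J k : ℕ} (hk : k + 1 < 2 * J + 6) :
    (dcol J (k + 1) = dcol J k + 1 ∧ drow J (k + 1) = drow J k) ∨
      (dcol J (k + 1) = dcol J k ∧ drow J (k + 1) = drow J k + 1) ∨
      (dcol J (k + 1) = dcol J k ∧ drow J k = drow J (k + 1) + 1) := by
  unfold dcol drow; split_ifs <;> first | contradiction | omega

/-- The detour visits no cell twice. [cite: MadrasSlade1993, §8.2, Theorem 8.2.1 (8.2.13), p. 269] -/
theorem shape_inj {J k k' : ℕ} (hk : k < 2 * J + 6) (hk' : k' < 2 * J + 6) (hc : dcol J k = dcol J k')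
    (hr : drow J k = drow J k') : k = k' := by
  unfold dcol at hc; unfold drow at hr; split_ifs at hc hr <;> first | contradiction | omega

/-- The first detour point is `(1, 0)`. [cite: MadrasSlade1993, §8.2, Theorem 8.2.1 (8.2.13), p. 269] -/
theorem shape_zero (J : ℕ) : dcol J 0 = 1 ∧ drow J 0 = 0 := by
  unfold dcol drow; simp

/-- The last detour point is `(4, 0)`. [cite: MadrasSlade1993, §8.2, Theorem 8.2.1 (8.2.13), p. 269] -/
theorem shape_last (J : ℕ) : dcol J (2 * J + 5) = 4 ∧ drow J (2 * J + 5) = 0 := by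
  unfold dcol drow; split_ifs <;> first | contradiction | omega

/-- The two top cells `(2, J+1)` and `(3, J+1)` are detour points. [cite: MadrasSlade1993, §8.2, Theorem 8.2.1 (8.2.13), p. 269] -/
theorem exists_top (J : ℕ) {j : ℕ} (hj2 : 2 ≤ j) (hj3 : j ≤ 3) :
    ∃ k < 2 * J + 6, dcol J k = j ∧ drow J k = J + 1 := by
  rcases Nat.lt_or_ge j 3 with h | h
  · refine ⟨J + 2, by omega, ?_, ?_⟩
    · unfold dcol; split_ifs <;> first | contradiction | omega
    · unfold drow; split_ifs <;> first | contradiction | omega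
  · refine ⟨J + 3, by omega, ?_, ?_⟩
    · unfold dcol; split_ifs <;> first | contradiction | omega
    · unfold drow; split_ifs <;> first | contradiction | omega

/-- The detour of the top crossing of a cut, as a list of cells: base column `x` (`= σ c`), row `z`, `J + 1` rows to
climb, coset bit `r`. [cite: MadrasSlade1993, §8.2, Theorem 8.2.1 (8.2.13), p. 269] -/
def zig (r x z : ℤ) (J : ℕ) : List (Site 2) :=
  (List.range (2 * J + 6)).map fun k => cellAt r (x + dcol J k) (z + drow J k)

/-- The detour has `2J + 6` points. [cite: MadrasSlade1993, §8.2, Theorem 8.2.1 (8.2.13), p. 269] -/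
theorem length_zig (r x z : ℤ) (J : ℕ) : (zig r x z J).length = 2 * J + 6 := by
  simp [zig]

/-- The detour is non-empty. [cite: MadrasSlade1993, §8.2, Theorem 8.2.1 (8.2.13), p. 269] -/
theorem zig_ne_nil (r x z : ℤ) (J : ℕ) : zig r x z J ≠ [] := by
  simp [zig]

/-- Membership in the detour. [cite: MadrasSlade1993, §8.2, Theorem 8.2.1 (8.2.13), p. 269] -/
theorem mem_zig {r x z : ℤ} {J : ℕ} {p : Site 2} :
    p ∈ zig r x z J ↔ ∃ k < 2 * J + 6, p = cellAt r (x + dcol J k) (z + drow J k) := by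
  simp only [zig, List.mem_map, List.mem_range]
  constructor
  · rintro ⟨k, hk, rfl⟩; exact ⟨k, hk, rfl⟩
  · rintro ⟨k, hk, rfl⟩; exact ⟨k, hk, rfl⟩

/-- Where the detour lives: columns `x+1 … x+4`, rows `z … z+J+1`, top row only in columns `x+2, x+3`, columns
`x+1` and `x+4` only in row `z`. [cite: MadrasSlade1993, §8.2, Theorem 8.2.1 (8.2.13), p. 269] -/
theorem mem_zig_bounds {r x z : ℤ} (hr : 0 ≤ r ∧ r ≤ 1) {J : ℕ} {p : Site 2} (hp : p ∈ zig r x z J) :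
    x + 1 ≤ colIdx p ∧ colIdx p ≤ x + 4 ∧ z ≤ p 1 ∧ p 1 ≤ z + J + 1 ∧
      (p 1 = z + J + 1 → x + 2 ≤ colIdx p ∧ colIdx p ≤ x + 3) ∧
      (colIdx p = x + 1 ∨ colIdx p = x + 4 → p 1 = z) := by
  obtain ⟨k, hk, rfl⟩ := mem_zig.1 hp
  have h := shape_range J k
  have h2 := @shape_top J k
  have h3 := @shape_ends J k
  rw [colIdx_cellAt hr, cellAt_one]
  refine ⟨by omega, by omega, by omega, by omega, fun ht => ?_, fun hc => ?_⟩
  · have := h2 (by omega); omega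
  · have := h3 (by omega); omega

/-- The two top cells of the detour. [cite: MadrasSlade1993, §8.2, Theorem 8.2.1 (8.2.13), p. 269] -/
theorem top_mem_zig (r x z : ℤ) (J : ℕ) {j : ℕ} (hj2 : 2 ≤ j) (hj3 : j ≤ 3) :
    cellAt r (x + j) (z + J + 1) ∈ zig r x z J := by
  obtain ⟨k, hk, hc, hrow⟩ := exists_top J hj2 hj3
  refine mem_zig.2 ⟨k, hk, ?_⟩
  rw [hc, hrow]; push_cast; ring_nf

/-- The detour visits no cell twice. [cite: MadrasSlade1993, §8.2, Theorem 8.2.1 (8.2.13), p. 269] -/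
theorem nodup_zig (r x z : ℤ) (J : ℕ) : (zig r x z J).Nodup := by
  refine (List.nodup_range.map_on ?_)
  intro k hk k' hk' h
  rw [cellAt_inj] at h
  exact shape_inj (List.mem_range.1 hk) (List.mem_range.1 hk') (by omega) (by omega)

/-- The detour is a brick chain. [cite: MadrasSlade1993, §8.2, Theorem 8.2.1 (8.2.13), p. 269] -/
theorem isChain_zig (r x z : ℤ) (J : ℕ) : (zig r x z J).IsChain brickGraph.Adj := by
  refine isChain_map_range _ _ fun k hk => ?_
  rw [adj_cellAt_iff]
  rcases shape_step hk with ⟨h1, h2⟩ | ⟨h1, h2⟩ | ⟨h1, h2⟩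
  · left; constructor <;> omega
  · right; right; left; constructor <;> omega
  · right; right; right; left; constructor <;> omega

/-- The reversed detour is a brick chain. [cite: MadrasSlade1993, §8.2, Theorem 8.2.1 (8.2.13), p. 269] -/
theorem isChain_reverse_zig (r x z : ℤ) (J : ℕ) : (zig r x z J).reverse.IsChain brickGraph.Adj := by
  rw [List.isChain_reverse]
  exact (isChain_zig r x z J).imp fun _ _ h => h.symm

/-- The detour starts at `(x+1, z)`. [cite: MadrasSlade1993, §8.2, Theorem 8.2.1 (8.2.13), p. 269] -/
theorem head?_zig (r x z : ℤ) (J : ℕ) : (zig r x z J).head? = some (cellAt r (x + 1) z) := by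
  have : 2 * J + 6 = (2 * J + 5) + 1 := by ring
  rw [zig, this, List.range_succ_eq_map, List.map_cons, List.head?_cons, (shape_zero J).1, (shape_zero J).2]
  simp

/-- The detour ends at `(x+4, z)`. [cite: MadrasSlade1993, §8.2, Theorem 8.2.1 (8.2.13), p. 269] -/
theorem getLast?_zig (r x z : ℤ) (J : ℕ) : (zig r x z J).getLast? = some (cellAt r (x + 4) z) := by
  have : 2 * J + 6 = (2 * J + 5) + 1 := by ring
  rw [zig, this, List.range_succ, List.map_append, List.map_singleton, List.getLast?_append,
    List.getLast?_singleton, (shape_last J).1, (shape_last J).2]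
  simp

/-- The reversed detour starts at `(x+4, z)`. [cite: MadrasSlade1993, §8.2, Theorem 8.2.1 (8.2.13), p. 269] -/
theorem head?_reverse_zig (r x z : ℤ) (J : ℕ) : (zig r x z J).reverse.head? = some (cellAt r (x + 4) z) := by
  rw [List.head?_reverse, getLast?_zig]

/-- The reversed detour ends at `(x+1, z)`. [cite: MadrasSlade1993, §8.2, Theorem 8.2.1 (8.2.13), p. 269] -/
theorem getLast?_reverse_zig (r x z : ℤ) (J : ℕ) : (zig r x z J).reverse.getLast? = some (cellAt r (x + 1) z) := by
  rw [List.getLast?_reverse, head?_zig]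

/-! ### Ladder steps, interior sites, the side rule, crossings (placed walk `ω`, `n` steps, one cut `c`) -/

variable (ω : ℕ → Site 2) (n : ℕ)

/-- Step `t` is a LADDER step of the cut `c`: it joins the slanted columns `c` and `c + 1`.
[cite: MadrasSlade1993, §8.2, Theorem 8.2.1 (8.2.13), p. 269 (statement; slab insertion = the lane's proof)] -/
def IsLad (c : ℤ) (t : ℕ) : Prop :=
  (colIdx (ω t) = c ∧ colIdx (ω (t + 1)) = c + 1) ∨ (colIdx (ω t) = c + 1 ∧ colIdx (ω (t + 1)) = c)

/-- `IsLad` is decidable. [cite: MadrasSlade1993, §8.2, Theorem 8.2.1 (8.2.13), p. 269] -/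
instance (c : ℤ) (t : ℕ) : Decidable (IsLad ω c t) := by unfold IsLad; infer_instance

/-- Site `t` is INTERIOR for the cut `c`: both its steps are ladder steps of `c` (the time-local side rule).
[cite: MadrasSlade1993, §8.2, Theorem 8.2.1 (8.2.13), p. 269] -/
def Interior (c : ℤ) (t : ℕ) : Prop := 0 < t ∧ t < n ∧ IsLad ω c (t - 1) ∧ IsLad ω c t

/-- `Interior` is decidable. [cite: MadrasSlade1993, §8.2, Theorem 8.2.1 (8.2.13), p. 269] -/
instance (c : ℤ) (t : ℕ) : Decidable (Interior ω n c t) := by unfold Interior; infer_instance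

/-- **The side rule**: site `t` is RIGHT of the cut `c` if its column is `≥ c + 2`, or `= c + 1` and it is not
interior (RIGHT sites are the ones that move when the slab is inserted at `c`). [cite: MadrasSlade1993, §8.2, Theorem 8.2.1 (8.2.13), p. 269] -/
def IsRight (c : ℤ) (t : ℕ) : Prop := c + 2 ≤ colIdx (ω t) ∨ (colIdx (ω t) = c + 1 ∧ ¬ Interior ω n c t)

/-- `IsRight` is decidable. [cite: MadrasSlade1993, §8.2, Theorem 8.2.1 (8.2.13), p. 269] -/
instance (c : ℤ) (t : ℕ) : Decidable (IsRight ω n c t) := by unfold IsRight; infer_instance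

/-- Step `t` is a CROSSING of the cut `c`: exactly one of its ends is RIGHT. [cite: MadrasSlade1993, §8.2, Theorem 8.2.1 (8.2.13), p. 269] -/
def IsCross (c : ℤ) (t : ℕ) : Prop := ¬ (IsRight ω n c t ↔ IsRight ω n c (t + 1))

/-- `IsCross` is decidable. [cite: MadrasSlade1993, §8.2, Theorem 8.2.1 (8.2.13), p. 269] -/
instance (c : ℤ) (t : ℕ) : Decidable (IsCross ω n c t) := by unfold IsCross; infer_instance

/-- The cut of a step (the smaller of its two slanted columns). [cite: MadrasSlade1993, §8.2, Theorem 8.2.1 (8.2.13), p. 269] -/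
def cutOf (t : ℕ) : ℤ := min (colIdx (ω t)) (colIdx (ω (t + 1)))

/-- The time of the column-`(c+1)` end `v` of a ladder step of the cut `c = cutOf t`. [cite: MadrasSlade1993, §8.2, Theorem 8.2.1 (8.2.13), p. 269] -/
def vT (t : ℕ) : ℕ := if colIdx (ω t) < colIdx (ω (t + 1)) then t + 1 else t

/-- The crossing steps `< n` of the cut `c`. [cite: MadrasSlade1993, §8.2, Theorem 8.2.1 (8.2.13), p. 269] -/
def crossTimes (c : ℤ) : Finset ℕ := (Finset.range n).filter fun t => IsCross ω n c t

/-- Step `t` is a crossing of `c` whose end `v` has maximal row (the TOP crossing of the cut).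
[cite: MadrasSlade1993, §8.2, Theorem 8.2.1 (8.2.13), p. 269] -/
def IsTop (c : ℤ) (t : ℕ) : Prop := ∀ t' ∈ crossTimes ω n c, ω (vT ω t') 1 ≤ ω (vT ω t) 1

/-- `IsTop` is decidable. [cite: MadrasSlade1993, §8.2, Theorem 8.2.1 (8.2.13), p. 269] -/
instance (c : ℤ) (t : ℕ) : Decidable (IsTop ω n c t) := by unfold IsTop; infer_instance

/-- The number of cuts of `R` that site `t` is RIGHT of. [cite: MadrasSlade1993, §8.2, Theorem 8.2.1 (8.2.13), p. 269] -/
def kR (R : Finset ℤ) (t : ℕ) : ℕ := (R.filter fun c => IsRight ω n c t).card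

/-- The new slanted column of site `t`: four columns to the right for each cut of `R` it is RIGHT of, normalised so
that the start does not move. [cite: MadrasSlade1993, §8.2, Theorem 8.2.1 (8.2.13), p. 269] -/
def ncol (R : Finset ℤ) (t : ℕ) : ℤ := colIdx (ω t) + 4 * ((kR ω n R t : ℤ) - (kR ω n R 0 : ℤ))

/-- The ANCHOR of site `t`: its image cell (same row, new column, same coset). [cite: MadrasSlade1993, §8.2, Theorem 8.2.1 (8.2.13), p. 269] -/
def anchor (R : Finset ℤ) (t : ℕ) : Site 2 := cellAt (cosetBit (ω 0)) (ncol ω n R t) (ω t 1)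

variable {ω n}

/-- Membership in `crossTimes`. [cite: MadrasSlade1993, §8.2, Theorem 8.2.1 (8.2.13), p. 269] -/
theorem mem_crossTimes {c : ℤ} {t : ℕ} : t ∈ crossTimes ω n c ↔ t < n ∧ IsCross ω n c t := by
  simp [crossTimes]

/-! ### Strip walks -/

/-- The standing hypotheses: `ω` is an `n`-step self-avoiding walk of `𝕋` (brick graph) in the rows `0 … T`.
[cite: MadrasSlade1993, §8.2, eq. (8.2.1), p. 267] -/
structure StripWalk (T : ℕ) (ω : ℕ → Site 2) (n : ℕ) : Prop where
  adj : ∀ t < n, brickGraph.Adj (ω t) (ω (t + 1))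
  inj : Set.InjOn ω {i | i ≤ n}
  row_nonneg : ∀ t ≤ n, 0 ≤ ω t 1
  row_le : ∀ t ≤ n, ω t 1 ≤ (T : ℤ)

variable {T : ℕ}

/-- The coset bit is constant along a strip walk. [cite: Grimmett2018, §5.5] -/
theorem StripWalk.cosetBit_eq (hW : StripWalk T ω n) : ∀ t ≤ n, cosetBit (ω t) = cosetBit (ω 0)
  | 0, _ => rfl
  | t + 1, ht => by rw [cosetBit_step (hW.adj t (by omega)), hW.cosetBit_eq t (by omega)]

/-- The coset bit of a strip walk is `0` or `1`. [cite: Grimmett2018, §5.5] -/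
theorem StripWalk.bit (_hW : StripWalk T ω n) : 0 ≤ cosetBit (ω 0) ∧ cosetBit (ω 0) ≤ 1 := cosetBit_nonneg_le _

/-- A walk site is the cell of its column and row on the walk's coset. [cite: Grimmett2018, §5.5] -/
theorem StripWalk.eq_cell (hW : StripWalk T ω n) {t : ℕ} (ht : t ≤ n) :
    ω t = cellAt (cosetBit (ω 0)) (colIdx (ω t)) (ω t 1) := by
  rw [← hW.cosetBit_eq t ht]; exact eq_cellAt (ω t)

/-- **The steps of a strip walk in slanted coordinates**: `(±1,0)`, `(0,±1)`, `±(1,−1)`. [cite: Grimmett2018, §5.5] -/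
theorem StripWalk.step (hW : StripWalk T ω n) {t : ℕ} (ht : t < n) :
    (colIdx (ω (t + 1)) = colIdx (ω t) + 1 ∧ ω (t + 1) 1 = ω t 1) ∨
      (colIdx (ω t) = colIdx (ω (t + 1)) + 1 ∧ ω (t + 1) 1 = ω t 1) ∨
      (colIdx (ω (t + 1)) = colIdx (ω t) ∧ ω (t + 1) 1 = ω t 1 + 1) ∨
      (colIdx (ω (t + 1)) = colIdx (ω t) ∧ ω t 1 = ω (t + 1) 1 + 1) ∨
      (colIdx (ω (t + 1)) = colIdx (ω t) + 1 ∧ ω t 1 = ω (t + 1) 1 + 1) ∨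
      (colIdx (ω t) = colIdx (ω (t + 1)) + 1 ∧ ω (t + 1) 1 = ω t 1 + 1) := by
  have h := hW.adj t ht
  rw [hW.eq_cell ht.le, hW.eq_cell (by omega : t + 1 ≤ n), adj_cellAt_iff] at h
  exact h

/-- Two walk sites with the same column and row are visited at the same time. [cite: MadrasSlade1993, §8.2] -/
theorem StripWalk.time_eq (hW : StripWalk T ω n) {t t' : ℕ} (ht : t ≤ n) (ht' : t' ≤ n)
    (hc : colIdx (ω t) = colIdx (ω t')) (hr : ω t 1 = ω t' 1) : t = t' :=
  hW.inj ht ht' (eq_of_colIdx_eq hc hr (by rw [hW.cosetBit_eq t ht, hW.cosetBit_eq t' ht']))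

/-! ### The structure of crossings -/

/-- **A crossing is a ladder step whose column-`(c+1)` end is RIGHT and whose column-`c` end is not.**
[cite: MadrasSlade1993, §8.2, Theorem 8.2.1 (8.2.13), p. 269 (statement; slab insertion = the lane's proof)] -/
theorem cross_spec (hW : StripWalk T ω n) {c : ℤ} {t : ℕ} (ht : t < n) (h : IsCross ω n c t) :
    (colIdx (ω t) = c ∧ colIdx (ω (t + 1)) = c + 1 ∧ ¬ IsRight ω n c t ∧ IsRight ω n c (t + 1)) ∨
      (colIdx (ω t) = c + 1 ∧ colIdx (ω (t + 1)) = c ∧ IsRight ω n c t ∧ ¬ IsRight ω n c (t + 1)) := by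
  unfold IsCross at h
  have hs := hW.step ht
  -- neither end is interior through a non-ladder step `t`
  have key : ¬ IsLad ω c t → ¬ Interior ω n c t ∧ ¬ Interior ω n c (t + 1) := fun hl =>
    ⟨fun hi => hl hi.2.2.2, fun hi => hl (by have := hi.2.2.1; simpa using this)⟩
  by_cases hl : IsLad ω c t
  · rcases hl with ⟨h1, h2⟩ | ⟨h1, h2⟩
    · left
      have hn : ¬ IsRight ω n c t := by rintro (hx | ⟨hx, -⟩) <;> omega
      refine ⟨h1, h2, hn, ?_⟩
      by_contra h'
      exact h ⟨fun x => absurd x hn, fun x => absurd x h'⟩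
    · right
      have hn : ¬ IsRight ω n c (t + 1) := by rintro (hx | ⟨hx, -⟩) <;> omega
      refine ⟨h1, h2, ?_, hn⟩
      by_contra h'
      exact h ⟨fun x => absurd x h', fun x => absurd x hn⟩
  · exfalso
    obtain ⟨hi, hi'⟩ := key hl
    unfold IsLad at hl
    apply h
    have e1 : IsRight ω n c t ↔ c + 1 ≤ colIdx (ω t) := by
      unfold IsRight
      constructor
      · rintro (hx | ⟨hx, -⟩) <;> omega
      · intro hx
        by_cases h2 : c + 2 ≤ colIdx (ω t)
        · exact Or.inl h2
        · exact Or.inr ⟨by omega, hi⟩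
    have e2 : IsRight ω n c (t + 1) ↔ c + 1 ≤ colIdx (ω (t + 1)) := by
      unfold IsRight
      constructor
      · rintro (hx | ⟨hx, -⟩) <;> omega
      · intro hx
        by_cases h2 : c + 2 ≤ colIdx (ω (t + 1))
        · exact Or.inl h2
        · exact Or.inr ⟨by omega, hi'⟩
    rw [e1, e2]
    rcases hs with ⟨a, -⟩ | ⟨a, -⟩ | ⟨a, -⟩ | ⟨a, -⟩ | ⟨a, -⟩ | ⟨a, -⟩
    all_goals (constructor <;> intro hx <;> omega)

/-- The end `v` of a crossing: time `vT t ∈ {t, t+1}`, column `c + 1`, RIGHT; the other end has column `c`.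
[cite: MadrasSlade1993, §8.2, Theorem 8.2.1 (8.2.13), p. 269] -/
theorem cross_v (hW : StripWalk T ω n) {c : ℤ} {t : ℕ} (ht : t < n) (h : IsCross ω n c t) :
    colIdx (ω (vT ω t)) = c + 1 ∧ IsRight ω n c (vT ω t) ∧ cutOf ω t = c ∧ IsLad ω c t ∧
      ((vT ω t = t + 1 ∧ colIdx (ω t) = c) ∨ (vT ω t = t ∧ colIdx (ω (t + 1)) = c)) := by
  rcases cross_spec hW ht h with ⟨h1, h2, -, h4⟩ | ⟨h1, h2, h3, -⟩
  · have hv : vT ω t = t + 1 := by unfold vT; rw [if_pos (by omega)]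
    rw [hv]
    exact ⟨h2, h4, by unfold cutOf; rw [h1, h2]; simp, Or.inl ⟨h1, h2⟩, Or.inl ⟨rfl, h1⟩⟩
  · have hv : vT ω t = t := by unfold vT; rw [if_neg (by omega)]
    rw [hv]
    exact ⟨h1, h3, by unfold cutOf; rw [h1, h2]; simp, Or.inr ⟨h1, h2⟩, Or.inr ⟨rfl, h2⟩⟩

/-- A RIGHT site of column `c + 1` is not interior. [cite: MadrasSlade1993, §8.2, Theorem 8.2.1 (8.2.13), p. 269] -/
theorem not_interior_of_isRight {c : ℤ} {s : ℕ} (h : IsRight ω n c s) (hc : colIdx (ω s) = c + 1) :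
    ¬ Interior ω n c s := by
  rcases h with h | ⟨-, h⟩
  · omega
  · exact h

/-- **Distinct crossings of one cut have their ends `v` in distinct rows** (two crossings sharing `v` would make `v`
interior). [cite: MadrasSlade1993, §8.2, Theorem 8.2.1 (8.2.13), p. 269 (statement; slab insertion = the lane's proof)] -/
theorem crossTimes_row_inj (hW : StripWalk T ω n) {c : ℤ} {t t' : ℕ} (ht : t ∈ crossTimes ω n c)
    (ht' : t' ∈ crossTimes ω n c) (h : ω (vT ω t) 1 = ω (vT ω t') 1) : t = t' := by
  obtain ⟨htn, htc⟩ := mem_crossTimes.1 ht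
  obtain ⟨htn', htc'⟩ := mem_crossTimes.1 ht'
  obtain ⟨hc1, hR1, -, hL1, hv1⟩ := cross_v hW htn htc
  obtain ⟨hc2, -, -, hL2, hv2⟩ := cross_v hW htn' htc'
  have hvn : vT ω t ≤ n := by rcases hv1 with ⟨e, -⟩ | ⟨e, -⟩ <;> omega
  have hvn' : vT ω t' ≤ n := by rcases hv2 with ⟨e, -⟩ | ⟨e, -⟩ <;> omega
  have hs : vT ω t = vT ω t' := hW.time_eq hvn hvn' (by rw [hc1, hc2]) h
  by_contra hne
  apply not_interior_of_isRight hR1 hc1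
  -- the two ladder steps `t ≠ t'` both end at `v`: they are the steps before and after `v`
  rcases hv1 with ⟨e1, -⟩ | ⟨e1, -⟩ <;> rcases hv2 with ⟨e2, -⟩ | ⟨e2, -⟩
  · omega
  · refine ⟨by omega, by omega, ?_, ?_⟩
    · rw [e1, Nat.add_sub_cancel]; exact hL1
    · have : t' = t + 1 := by omega
      rw [e1, ← this]; exact hL2
  · refine ⟨by omega, by omega, ?_, ?_⟩
    · rw [e1, show t - 1 = t' by omega]; exact hL2
    · rw [e1]; exact hL1
  · omega

/-- A cut with a non-RIGHT site and a RIGHT site has a crossing (discrete intermediate values of the side along the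
walk). [cite: MadrasSlade1993, §8.2, Theorem 8.2.1 (8.2.13), p. 269] -/
theorem crossTimes_nonempty {c : ℤ} {s s' : ℕ} (hs : s ≤ n) (hs' : s' ≤ n) (h1 : ¬ IsRight ω n c s)
    (h2 : IsRight ω n c s') : (crossTimes ω n c).Nonempty := by
  by_contra hne
  rw [Finset.not_nonempty_iff_eq_empty] at hne
  have hstep : ∀ t < n, (IsRight ω n c t ↔ IsRight ω n c (t + 1)) := by
    intro t ht
    by_contra hx
    have : t ∈ crossTimes ω n c := mem_crossTimes.2 ⟨ht, hx⟩
    rw [hne] at this; exact absurd this (Finset.notMem_empty t)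
  have hall : ∀ t ≤ n, (IsRight ω n c t ↔ IsRight ω n c 0) := by
    intro t ht
    induction t with
    | zero => exact Iff.rfl
    | succ k ih => exact (hstep k (by omega)).symm.trans (ih (by omega))
  exact h1 ((hall s hs).2 ((hall s' hs').1 h2))

/-- A site of column `≤ c` is not RIGHT; a site of column `≥ c + 2` is RIGHT. [cite: MadrasSlade1993, §8.2, Theorem 8.2.1 (8.2.13), p. 269] -/
theorem isRight_of_col {c : ℤ} {t : ℕ} :
    (colIdx (ω t) ≤ c → ¬ IsRight ω n c t) ∧ (c + 2 ≤ colIdx (ω t) → IsRight ω n c t) :=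
  ⟨fun h hr => by rcases hr with hr | ⟨hr, -⟩ <;> omega, fun h => Or.inl h⟩

/-- Every top crossing exists when there is a crossing. [cite: MadrasSlade1993, §8.2, Theorem 8.2.1 (8.2.13), p. 269] -/
theorem exists_isTop {c : ℤ} (hc : (crossTimes ω n c).Nonempty) : ∃ t ∈ crossTimes ω n c, IsTop ω n c t :=
  Finset.exists_max_image _ (fun t => ω (vT ω t) 1) hc

/-! ### The new columns -/

/-- Which cuts a site is RIGHT of: the cuts `< i − 1`, and `i − 1` unless the site is interior for it (`i` = its column).
[cite: MadrasSlade1993, §8.2, Theorem 8.2.1 (8.2.13), p. 269] -/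
theorem isRight_iff {c : ℤ} {t : ℕ} :
    IsRight ω n c t ↔ c < colIdx (ω t) ∧ ¬ (c = colIdx (ω t) - 1 ∧ Interior ω n c t) := by
  unfold IsRight
  constructor
  · rintro (h | ⟨h, hi⟩)
    · exact ⟨by omega, fun h' => by omega⟩
    · exact ⟨by omega, fun h' => hi h'.2⟩
  · rintro ⟨h1, h2⟩
    by_cases e : c = colIdx (ω t) - 1
    · exact Or.inr ⟨by omega, fun hi => h2 ⟨e, hi⟩⟩
    · exact Or.inl (by omega)

/-- The start is RIGHT of exactly the cuts to the left of its column. [cite: MadrasSlade1993, §8.2, Theorem 8.2.1 (8.2.13), p. 269] -/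
theorem isRight_zero {c : ℤ} : IsRight ω n c 0 ↔ c < colIdx (ω 0) := by
  rw [isRight_iff]
  exact ⟨fun h => h.1, fun h => ⟨h, fun h' => absurd h'.2.1 (lt_irrefl 0)⟩⟩

/-- `kR` at a site interior for no cut of `R` at its own column: the number of cuts of `R` left of its column.
[cite: MadrasSlade1993, §8.2, Theorem 8.2.1 (8.2.13), p. 269] -/
theorem kR_eq_of_not {t : ℕ} (h : ¬ ((colIdx (ω t) - 1) ∈ R ∧ Interior ω n (colIdx (ω t) - 1) t)) :
    kR ω n R t = (R.filter fun c => c < colIdx (ω t)).card := by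
  unfold kR
  congr 1
  refine Finset.filter_congr fun c hc => ?_
  rw [isRight_iff]
  constructor
  · exact fun h' => h'.1
  · intro h'
    refine ⟨h', fun ⟨e, hi⟩ => h ⟨?_, ?_⟩⟩
    · rw [← e]; exact hc
    · rw [← e]; exact hi

/-- `kR` at a site interior for the cut `i − 1 ∈ R` at its column `i`: one less.
[cite: MadrasSlade1993, §8.2, Theorem 8.2.1 (8.2.13), p. 269] -/
theorem kR_eq_of_interior {t : ℕ} (hm : (colIdx (ω t) - 1) ∈ R) (hi : Interior ω n (colIdx (ω t) - 1) t) :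
    kR ω n R t + 1 = (R.filter fun c => c < colIdx (ω t)).card := by
  unfold kR
  have e : (R.filter fun c => c < colIdx (ω t)) =
      insert (colIdx (ω t) - 1) (R.filter fun c => IsRight ω n c t) := by
    ext c
    rw [Finset.mem_insert, Finset.mem_filter, Finset.mem_filter, isRight_iff]
    constructor
    · rintro ⟨hc, hlt⟩
      by_cases e : c = colIdx (ω t) - 1
      · exact Or.inl e
      · exact Or.inr ⟨hc, hlt, fun h => e h.1⟩
    · rintro (rfl | ⟨hc, hlt, -⟩)
      · exact ⟨hm, by omega⟩
      · exact ⟨hc, hlt⟩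
  rw [e, Finset.card_insert_of_notMem]
  rw [Finset.mem_filter, isRight_iff]
  exact fun h => h.2.2 ⟨rfl, hi⟩

/-- **The new column of a non-interior site is `σ` of its column** (base column = the start's).
[cite: MadrasSlade1993, §8.2, Theorem 8.2.1 (8.2.13), p. 269] -/
theorem ncol_eq_of_not {t : ℕ} (h : ¬ ((colIdx (ω t) - 1) ∈ R ∧ Interior ω n (colIdx (ω t) - 1) t)) :
    ncol ω n R t = colMap (colIdx (ω 0)) R (colIdx (ω t)) := by
  unfold ncol
  rw [kR_eq_of_not h, kR_eq_of_not (t := 0) (fun h' => absurd h'.2.1 (lt_irrefl 0)), colMap_eq_card]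

/-- **The new column of an interior site of column `i` (cut `i − 1 ∈ R`) is `σ(i−1) + 1`** (it does not move with
the slab of `i − 1`). [cite: MadrasSlade1993, §8.2, Theorem 8.2.1 (8.2.13), p. 269] -/
theorem ncol_eq_of_interior {t : ℕ} (hm : (colIdx (ω t) - 1) ∈ R) (hi : Interior ω n (colIdx (ω t) - 1) t) :
    ncol ω n R t = colMap (colIdx (ω 0)) R (colIdx (ω t) - 1) + 1 := by
  unfold ncol
  have h1 : ((kR ω n R t : ℤ) + 1 = ((R.filter fun c => c < colIdx (ω t)).card : ℤ)) := by
    exact_mod_cast kR_eq_of_interior hm hi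
  have e := colMap_succ_of_mem (x₀ := colIdx (ω 0)) hm
  rw [sub_add_cancel, colMap_eq_card, colMap_eq_card] at e
  rw [kR_eq_of_not (t := 0) (fun h' => absurd h'.2.1 (lt_irrefl 0)), colMap_eq_card]
  omega

/-- The new column of a site of column `i` lies in `(σ(i−1), σ i]`. [cite: MadrasSlade1993, §8.2, Theorem 8.2.1 (8.2.13), p. 269] -/
theorem ncol_mem_Ioc (t : ℕ) :
    colMap (colIdx (ω 0)) R (colIdx (ω t) - 1) < ncol ω n R t ∧
      ncol ω n R t ≤ colMap (colIdx (ω 0)) R (colIdx (ω t)) := by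
  by_cases h : (colIdx (ω t) - 1) ∈ R ∧ Interior ω n (colIdx (ω t) - 1) t
  · rw [ncol_eq_of_interior h.1 h.2]
    have := colMap_succ_of_mem (x₀ := colIdx (ω 0)) h.1
    rw [sub_add_cancel] at this; omega
  · rw [ncol_eq_of_not h]
    have := colMap_lt_succ (colIdx (ω 0)) R (colIdx (ω t) - 1)
    rw [sub_add_cancel] at this; omega

/-- The start does not move. [cite: MadrasSlade1993, §8.2, Theorem 8.2.1 (8.2.13), p. 269] -/
theorem ncol_zero : ncol ω n R 0 = colIdx (ω 0) := by
  unfold ncol; simp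

/-- The anchor of the start is the start. [cite: MadrasSlade1993, §8.2, Theorem 8.2.1 (8.2.13), p. 269] -/
theorem anchor_zero : anchor ω n R 0 = ω 0 := by
  unfold anchor; rw [ncol_zero]; exact (eq_cellAt (ω 0)).symm

/-- Rows and columns of anchors. [cite: MadrasSlade1993, §8.2, Theorem 8.2.1 (8.2.13), p. 269] -/
theorem anchor_coords (hW : StripWalk T ω n) (t : ℕ) :
    anchor ω n R t 1 = ω t 1 ∧ colIdx (anchor ω n R t) = ncol ω n R t := by
  unfold anchor; exact ⟨rfl, colIdx_cellAt hW.bit _ _⟩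

/-- **Anchors are injective in time.** [cite: MadrasSlade1993, §8.2, Theorem 8.2.1 (8.2.13), p. 269] -/
theorem anchor_inj (hW : StripWalk T ω n) {t t' : ℕ} (ht : t ≤ n) (ht' : t' ≤ n)
    (h : anchor ω n R t = anchor ω n R t') : t = t' := by
  unfold anchor at h
  rw [cellAt_inj] at h
  have h1 := ncol_mem_Ioc (R := R) (ω := ω) (n := n) t
  have h2 := ncol_mem_Ioc (R := R) (ω := ω) (n := n) t'
  rw [h.1] at h1
  exact hW.time_eq ht ht' (eq_of_mem_Ioc h1.1 h1.2 h2.1 h2.2) h.2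

/-- No anchor lies in a pure slab column `σ c + 2 … σ c + 4`. [cite: MadrasSlade1993, §8.2, Theorem 8.2.1 (8.2.13), p. 269] -/
theorem ncol_not_slab {c : ℤ} (hc : c ∈ R) (t : ℕ) :
    ¬ (colMap (colIdx (ω 0)) R c + 2 ≤ ncol ω n R t ∧ ncol ω n R t ≤ colMap (colIdx (ω 0)) R c + 4) := by
  rintro ⟨h1, h2⟩
  have h := ncol_mem_Ioc (R := R) (ω := ω) (n := n) t
  have h5 := colMap_succ_of_mem (x₀ := colIdx (ω 0)) hc
  have hi : colIdx (ω t) = c + 1 :=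
    eq_of_mem_Ioc (x₀ := colIdx (ω 0)) (R := R) h.1 h.2 (by rw [add_sub_cancel_right]; omega) (by omega)
  by_cases hint : (colIdx (ω t) - 1) ∈ R ∧ Interior ω n (colIdx (ω t) - 1) t
  · rw [ncol_eq_of_interior hint.1 hint.2, hi, add_sub_cancel_right] at h1; omega
  · rw [ncol_eq_of_not hint, hi, h5] at h2; omega

/-- An anchor in the column `σ c + 1` (`c ∈ R`) is an interior site of column `c + 1`.
[cite: MadrasSlade1993, §8.2, Theorem 8.2.1 (8.2.13), p. 269] -/
theorem interior_of_ncol_eq {c : ℤ} (hc : c ∈ R) {t : ℕ} (h : ncol ω n R t = colMap (colIdx (ω 0)) R c + 1) :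
    colIdx (ω t) = c + 1 ∧ Interior ω n c t := by
  have hI := ncol_mem_Ioc (R := R) (ω := ω) (n := n) t
  have h5 := colMap_succ_of_mem (x₀ := colIdx (ω 0)) hc
  have hi : colIdx (ω t) = c + 1 :=
    eq_of_mem_Ioc (x₀ := colIdx (ω 0)) (R := R) hI.1 hI.2 (by rw [add_sub_cancel_right]; omega) (by omega)
  refine ⟨hi, ?_⟩
  by_contra hni
  have := ncol_eq_of_not (R := R) (t := t) (by rw [hi, add_sub_cancel_right]; exact fun h' => hni h'.2)
  rw [hi, h5] at this; omega


/-! ### Strip-walk bookkeeping -/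

/-- `row + (T − row) = T` for a site of a strip walk. [cite: MadrasSlade1993, §8.2, eq. (8.2.1), p. 267] -/
theorem StripWalk.row_add (hW : StripWalk T ω n) {t : ℕ} (ht : t ≤ n) :
    ω t 1 + ((T - (ω t 1).toNat : ℕ) : ℤ) = (T : ℤ) := by
  have h0 := hW.row_nonneg t ht
  have hT := hW.row_le t ht
  have e := Int.toNat_of_nonneg h0
  have : (ω t 1).toNat ≤ T := by omega
  push_cast [this]
  omega

/-- The time `vT t` is `t` or `t + 1`. [cite: MadrasSlade1993, §8.2, Theorem 8.2.1 (8.2.13), p. 269] -/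
theorem vT_le (t : ℕ) : t ≤ vT ω t ∧ vT ω t ≤ t + 1 := by
  unfold vT; split_ifs <;> omega

/-! ### The blocks and the image list -/

/-- The straight bridge on the row `z` through the four slab columns `x+1 … x+4`. [cite: MadrasSlade1993, §8.2, Theorem 8.2.1 (8.2.13), p. 269 (statement; slab insertion = the lane's proof)] -/
def bridge (r x z : ℤ) : List (Site 2) := (List.range 4).map fun j : ℕ => cellAt r (x + 1 + j) z

/-- The block of image points replacing the step `t` (not including the next anchor): the anchor alone; or, for a
crossing of a cut `c ∈ R`, the anchor followed by the straight bridge on the row of the end `v` (non-top crossing)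
or by the detour (top crossing), traversed forwards if the step goes from column `c` to column `c+1`, backwards
otherwise. [cite: MadrasSlade1993, §8.2, Theorem 8.2.1 (8.2.13), p. 269 (statement; slab insertion = the lane's proof)] -/
def block (T : ℕ) (R : Finset ℤ) (ω : ℕ → Site 2) (n t : ℕ) : List (Site 2) :=
  if cutOf ω t ∈ R ∧ IsCross ω n (cutOf ω t) t then
    if IsTop ω n (cutOf ω t) t then
      anchor ω n R t ::
        (if colIdx (ω t) < colIdx (ω (t + 1)) then
            zig (cosetBit (ω 0)) (colMap (colIdx (ω 0)) R (cutOf ω t)) (ω (vT ω t) 1) (T - (ω (vT ω t) 1).toNat)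
          else (zig (cosetBit (ω 0)) (colMap (colIdx (ω 0)) R (cutOf ω t)) (ω (vT ω t) 1)
            (T - (ω (vT ω t) 1).toNat)).reverse)
    else
      anchor ω n R t ::
        (if colIdx (ω t) < colIdx (ω (t + 1)) then
            bridge (cosetBit (ω 0)) (colMap (colIdx (ω 0)) R (cutOf ω t)) (ω (vT ω t) 1)
          else (bridge (cosetBit (ω 0)) (colMap (colIdx (ω 0)) R (cutOf ω t)) (ω (vT ω t) 1)).reverse)
  else [anchor ω n R t]

/-- The image list `Ψ(ω, R)`: the blocks of the steps `0, …, n-1`, then the last anchor.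
[cite: MadrasSlade1993, §8.2, Theorem 8.2.1 (8.2.13), p. 269] -/
def imageList (T : ℕ) (R : Finset ℤ) (ω : ℕ → Site 2) (n : ℕ) : List (Site 2) :=
  (List.range n).flatMap (block T R ω n) ++ [anchor ω n R n]

/-- The extra length of the block of a crossing `t` of the cut `c`. [cite: MadrasSlade1993, §8.2, Theorem 8.2.1 (8.2.13), p. 269] -/
def extra (T : ℕ) (ω : ℕ → Site 2) (n : ℕ) (c : ℤ) (t : ℕ) : ℕ :=
  if IsTop ω n c t then 2 * (T - (ω (vT ω t) 1).toNat) + 6 else 4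

/-- The cost of the cut `c`: the total extra length of the blocks of its crossings. [cite: MadrasSlade1993, §8.2, Theorem 8.2.1 (8.2.13), p. 269] -/
def cost (T : ℕ) (ω : ℕ → Site 2) (n : ℕ) (c : ℤ) : ℕ :=
  ∑ t ∈ crossTimes ω n c, extra T ω n c t

/-- Blocks are non-empty. [cite: MadrasSlade1993, §8.2, Theorem 8.2.1 (8.2.13), p. 269] -/
theorem block_ne_nil (T : ℕ) (R : Finset ℤ) (ω : ℕ → Site 2) (n t : ℕ) : block T R ω n t ≠ [] := by
  unfold block; split_ifs <;> simp

/-- Every block starts with the anchor. [cite: MadrasSlade1993, §8.2, Theorem 8.2.1 (8.2.13), p. 269] -/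
theorem head?_block (T : ℕ) (R : Finset ℤ) (ω : ℕ → Site 2) (n t : ℕ) :
    (block T R ω n t).head? = some (anchor ω n R t) := by
  unfold block; split_ifs <;> simp

/-- Every block is its anchor followed by a rest. [cite: MadrasSlade1993, §8.2, Theorem 8.2.1 (8.2.13), p. 269] -/
theorem block_eq_cons (T : ℕ) (R : Finset ℤ) (ω : ℕ → Site 2) (n t : ℕ) :
    ∃ rest, block T R ω n t = anchor ω n R t :: rest := by
  unfold block; split_ifs <;> exact ⟨_, rfl⟩

/-- Membership in the straight bridge. [cite: MadrasSlade1993, §8.2, Theorem 8.2.1 (8.2.13), p. 269] -/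
theorem mem_bridge {r x z : ℤ} {p : Site 2} :
    p ∈ bridge r x z ↔ ∃ j : ℕ, j < 4 ∧ p = cellAt r (x + 1 + j) z := by
  simp only [bridge, List.mem_map, List.mem_range]
  constructor
  · rintro ⟨j, hj, rfl⟩; exact ⟨j, hj, rfl⟩
  · rintro ⟨j, hj, rfl⟩; exact ⟨j, hj, rfl⟩

/-- The straight bridge has four cells. [cite: MadrasSlade1993, §8.2, Theorem 8.2.1 (8.2.13), p. 269] -/
theorem length_bridge (r x z : ℤ) : (bridge r x z).length = 4 := by
  simp [bridge]

/-- The straight bridge has no repeated cell. [cite: MadrasSlade1993, §8.2, Theorem 8.2.1 (8.2.13), p. 269] -/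
theorem nodup_bridge (r x z : ℤ) : (bridge r x z).Nodup := by
  refine List.nodup_range.map_on ?_
  intro k _ k' _ h
  rw [cellAt_inj] at h
  omega

/-- The straight bridge is a brick chain. [cite: MadrasSlade1993, §8.2, Theorem 8.2.1 (8.2.13), p. 269] -/
theorem isChain_bridge (r x z : ℤ) : (bridge r x z).IsChain brickGraph.Adj := by
  refine isChain_map_range _ _ fun k _ => ?_
  rw [adj_cellAt_iff]
  left; constructor <;> push_cast <;> ring

/-- The reversed straight bridge is a brick chain. [cite: MadrasSlade1993, §8.2, Theorem 8.2.1 (8.2.13), p. 269] -/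
theorem isChain_reverse_bridge (r x z : ℤ) : (bridge r x z).reverse.IsChain brickGraph.Adj := by
  rw [List.isChain_reverse]
  exact (isChain_bridge r x z).imp fun _ _ h => h.symm

/-- The straight bridge starts at `(x+1, z)`. [cite: MadrasSlade1993, §8.2, Theorem 8.2.1 (8.2.13), p. 269] -/
theorem head?_bridge (r x z : ℤ) : (bridge r x z).head? = some (cellAt r (x + 1) z) := by
  simp [bridge, List.range_succ_eq_map]

/-- The straight bridge ends at `(x+4, z)`. [cite: MadrasSlade1993, §8.2, Theorem 8.2.1 (8.2.13), p. 269] -/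
theorem getLast?_bridge (r x z : ℤ) : (bridge r x z).getLast? = some (cellAt r (x + 4) z) := by
  rw [bridge, show (4 : ℕ) = 3 + 1 from rfl, List.range_succ, List.map_append, List.map_singleton,
    List.getLast?_append, List.getLast?_singleton]
  simp only [Option.some_or]
  push_cast; ring_nf

/-- The reversed bridge starts at `(x+4, z)`. [cite: MadrasSlade1993, §8.2, Theorem 8.2.1 (8.2.13), p. 269] -/
theorem head?_reverse_bridge (r x z : ℤ) : (bridge r x z).reverse.head? = some (cellAt r (x + 4) z) := by
  rw [List.head?_reverse, getLast?_bridge]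

/-- The reversed bridge ends at `(x+1, z)`. [cite: MadrasSlade1993, §8.2, Theorem 8.2.1 (8.2.13), p. 269] -/
theorem getLast?_reverse_bridge (r x z : ℤ) : (bridge r x z).reverse.getLast? = some (cellAt r (x + 1) z) := by
  rw [List.getLast?_reverse, head?_bridge]

/-- A cell described by its own column and row. [cite: Grimmett2018, §5.5] -/
theorem cell_desc {r : ℤ} (hr : 0 ≤ r ∧ r ≤ 1) (i y : ℤ) :
    cellAt r i y = cellAt r (colIdx (cellAt r i y)) ((cellAt r i y) 1) ∧ colIdx (cellAt r i y) = i ∧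
      (cellAt r i y) 1 = y := by
  rw [colIdx_cellAt hr, cellAt_one]; exact ⟨rfl, rfl, rfl⟩

/-! ### The geometry of a crossing step -/

/-- **The anchors around a crossing of `c ∈ R`**: the column-`c` end goes to `σ c`, the column-`(c+1)` end `v` to
`σ c + 5`; the step is `(c, Y_u) → (c+1, Y_v)` with `Y_u ∈ {Y_v, Y_v + 1}` (forwards) or the reverse.
[cite: MadrasSlade1993, §8.2, Theorem 8.2.1 (8.2.13), p. 269 (statement; slab insertion = the lane's proof)] -/
theorem crossing_geometry (hW : StripWalk T ω n) {t : ℕ} (ht : t < n) (hR : cutOf ω t ∈ R)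
    (hx : IsCross ω n (cutOf ω t) t) :
    (colIdx (ω t) < colIdx (ω (t + 1)) ∧ vT ω t = t + 1 ∧
        ncol ω n R t = colMap (colIdx (ω 0)) R (cutOf ω t) ∧
        ncol ω n R (t + 1) = colMap (colIdx (ω 0)) R (cutOf ω t) + 5 ∧
        (ω t 1 = ω (t + 1) 1 ∨ ω t 1 = ω (t + 1) 1 + 1)) ∨
      (colIdx (ω (t + 1)) < colIdx (ω t) ∧ vT ω t = t ∧
        ncol ω n R t = colMap (colIdx (ω 0)) R (cutOf ω t) + 5 ∧
        ncol ω n R (t + 1) = colMap (colIdx (ω 0)) R (cutOf ω t) ∧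
        (ω (t + 1) 1 = ω t 1 ∨ ω (t + 1) 1 = ω t 1 + 1)) := by
  set c := cutOf ω t with hc
  obtain ⟨hvc, hvR, -, hL, hv⟩ := cross_v hW ht hx
  have h5 := colMap_succ_of_mem (x₀ := colIdx (ω 0)) hR
  have hs := hW.step ht
  -- the column-`c` end `u` is not interior for the cut `c - 1` (one of its steps is the ladder step `t` of `c`)
  have hu : ∀ s, (s = t ∨ s = t + 1) → colIdx (ω s) = c →
      ncol ω n R s = colMap (colIdx (ω 0)) R c := by
    intro s hs' hcs
    rw [ncol_eq_of_not, hcs]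
    rw [hcs]
    rintro ⟨-, hi⟩
    obtain ⟨-, -, h1, h2⟩ := hi
    rcases hs' with rfl | rfl
    · unfold IsLad at h2 hL; omega
    · rw [Nat.add_sub_cancel] at h1
      unfold IsLad at h1 hL; omega
  -- the end `v` is RIGHT, hence not interior for `c`
  have hvn : ncol ω n R (vT ω t) = colMap (colIdx (ω 0)) R c + 5 := by
    rw [ncol_eq_of_not, hvc, h5]
    rw [hvc, add_sub_cancel_right]
    exact fun h => not_interior_of_isRight hvR hvc h.2
  rcases hv with ⟨e, hcu⟩ | ⟨e, hcu⟩
  · left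
    rw [e] at hvc hvn
    refine ⟨by omega, e, hu t (Or.inl rfl) hcu, hvn, ?_⟩
    rcases hs with ⟨-, b⟩ | ⟨a, -⟩ | ⟨a, -⟩ | ⟨a, -⟩ | ⟨-, b⟩ | ⟨a, -⟩ <;> omega
  · right
    rw [e] at hvc hvn
    refine ⟨by omega, e, hvn, hu (t + 1) (Or.inr rfl) hcu, ?_⟩
    rcases hs with ⟨a, -⟩ | ⟨-, b⟩ | ⟨a, -⟩ | ⟨a, -⟩ | ⟨a, -⟩ | ⟨-, b⟩ <;> omega

/-- A step that is not a crossing of a cut of `R` through `cutOf` is a crossing of no cut of `R`; the two anchors are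
then translates of the two sites by the same vector. [cite: MadrasSlade1993, §8.2, Theorem 8.2.1 (8.2.13), p. 269] -/
theorem ncol_sub_eq_of_not (hW : StripWalk T ω n) {t : ℕ} (ht : t < n)
    (h : ¬ (cutOf ω t ∈ R ∧ IsCross ω n (cutOf ω t) t)) :
    ncol ω n R (t + 1) - colIdx (ω (t + 1)) = ncol ω n R t - colIdx (ω t) := by
  have hall : ∀ c ∈ R, (IsRight ω n c t ↔ IsRight ω n c (t + 1)) := by
    intro c hc
    by_contra hx
    obtain ⟨-, -, hcut, -⟩ := cross_v hW ht hx
    exact h ⟨hcut ▸ hc, hcut ▸ hx⟩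
  have hk : kR ω n R (t + 1) = kR ω n R t := by
    unfold kR; congr 1
    exact Finset.filter_congr fun c hc => (hall c hc).symm
  unfold ncol; rw [hk]; ring

/-! ### Where the points of a block live -/

/-- **Where the points of a block live**: the anchor, or an inserted cell of the cut `c = cutOf t ∈ R` in one of the
four slab columns `σ c + 1 … σ c + 4`, in the rows `Y_v … T + 1` (`= Y_v` unless the crossing is the top one), in
the top row only in the columns `σ c + 2, σ c + 3`, in the columns `σ c + 1, σ c + 4` only in the row `Y_v`; every
point is a cell of the walk's coset. [cite: MadrasSlade1993, §8.2, Theorem 8.2.1 (8.2.13), p. 269 (statement; slab insertion = the lane's proof)] -/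
theorem mem_block (hW : StripWalk T ω n) {t : ℕ} (ht : t < n) {z : Site 2} (hz : z ∈ block T R ω n t) :
    z = anchor ω n R t ∨
    (cutOf ω t ∈ R ∧ IsCross ω n (cutOf ω t) t ∧
      z = cellAt (cosetBit (ω 0)) (colIdx z) (z 1) ∧
      (colMap (colIdx (ω 0)) R (cutOf ω t) + 1 ≤ colIdx z ∧ colIdx z ≤ colMap (colIdx (ω 0)) R (cutOf ω t) + 4) ∧
      ω (vT ω t) 1 ≤ z 1 ∧ z 1 ≤ (T : ℤ) + 1 ∧ (¬ IsTop ω n (cutOf ω t) t → z 1 = ω (vT ω t) 1) ∧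
      (z 1 = (T : ℤ) + 1 →
        colMap (colIdx (ω 0)) R (cutOf ω t) + 2 ≤ colIdx z ∧ colIdx z ≤ colMap (colIdx (ω 0)) R (cutOf ω t) + 3) ∧
      (colIdx z = colMap (colIdx (ω 0)) R (cutOf ω t) + 1 ∨ colIdx z = colMap (colIdx (ω 0)) R (cutOf ω t) + 4 →
        z 1 = ω (vT ω t) 1)) := by
  have hr := hW.bit
  have hvn : vT ω t ≤ n := by have := vT_le (ω := ω) t; omega
  have e := hW.row_add hvn
  have hL := hW.row_le _ hvn
  unfold block at hz
  split_ifs at hz with h1 h2 h3 h3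
  · -- detour, forwards
    rcases List.mem_cons.1 hz with rfl | hz
    · exact Or.inl rfl
    · right
      have hb := mem_zig_bounds hr hz
      obtain ⟨k, hk, rfl⟩ := mem_zig.1 hz
      obtain ⟨-, hz2, hz3⟩ := cell_desc hr (colMap (colIdx (ω 0)) R (cutOf ω t) + dcol (T - (ω (vT ω t) 1).toNat) k)
        (ω (vT ω t) 1 + drow (T - (ω (vT ω t) 1).toNat) k)
      rw [hz2, hz3] at hb ⊢
      exact ⟨h1.1, h1.2, rfl, ⟨hb.1, hb.2.1⟩, hb.2.2.1, by omega, fun h => absurd h2 h,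
        fun h => hb.2.2.2.2.1 (by omega), hb.2.2.2.2.2⟩
  · -- detour, backwards
    rcases List.mem_cons.1 hz with rfl | hz
    · exact Or.inl rfl
    · right
      rw [List.mem_reverse] at hz
      have hb := mem_zig_bounds hr hz
      obtain ⟨k, hk, rfl⟩ := mem_zig.1 hz
      obtain ⟨-, hz2, hz3⟩ := cell_desc hr (colMap (colIdx (ω 0)) R (cutOf ω t) + dcol (T - (ω (vT ω t) 1).toNat) k)
        (ω (vT ω t) 1 + drow (T - (ω (vT ω t) 1).toNat) k)
      rw [hz2, hz3] at hb ⊢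
      exact ⟨h1.1, h1.2, rfl, ⟨hb.1, hb.2.1⟩, hb.2.2.1, by omega, fun h => absurd h2 h,
        fun h => hb.2.2.2.2.1 (by omega), hb.2.2.2.2.2⟩
  · -- straight bridge, forwards
    rcases List.mem_cons.1 hz with rfl | hz
    · exact Or.inl rfl
    · right
      obtain ⟨j, hj4, rfl⟩ := mem_bridge.1 hz
      obtain ⟨-, hz2, hz3⟩ := cell_desc hr (colMap (colIdx (ω 0)) R (cutOf ω t) + 1 + j) (ω (vT ω t) 1)
      rw [hz2, hz3]
      exact ⟨h1.1, h1.2, rfl, ⟨by omega, by omega⟩, le_rfl, by omega, fun _ => rfl, fun h => by omega,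
        fun _ => rfl⟩
  · -- straight bridge, backwards
    rcases List.mem_cons.1 hz with rfl | hz
    · exact Or.inl rfl
    · right
      rw [List.mem_reverse] at hz
      obtain ⟨j, hj4, rfl⟩ := mem_bridge.1 hz
      obtain ⟨-, hz2, hz3⟩ := cell_desc hr (colMap (colIdx (ω 0)) R (cutOf ω t) + 1 + j) (ω (vT ω t) 1)
      rw [hz2, hz3]
      exact ⟨h1.1, h1.2, rfl, ⟨by omega, by omega⟩, le_rfl, by omega, fun _ => rfl, fun h => by omega,
        fun _ => rfl⟩
  · simp only [List.mem_singleton] at hz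
    exact Or.inl hz

/-- All block points lie in the rows `0 … T+1`. [cite: MadrasSlade1993, §8.2, Theorem 8.2.1 (8.2.13), p. 269] -/
theorem row_mem_block (hW : StripWalk T ω n) {t : ℕ} (ht : t < n) {z : Site 2}
    (hz : z ∈ block T R ω n t) : 0 ≤ z 1 ∧ z 1 ≤ (T : ℤ) + 1 := by
  rcases mem_block hW ht hz with rfl | ⟨-, -, -, -, h1, h2, -⟩
  · rw [(anchor_coords (R := R) hW t).1]
    exact ⟨hW.row_nonneg t ht.le, by have := hW.row_le t ht.le; omega⟩
  · have hvn : vT ω t ≤ n := by have := vT_le (ω := ω) t; omega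
    exact ⟨(hW.row_nonneg _ hvn).trans h1, h2⟩

/-- An anchor is never an inserted cell: if the anchor of `s` lies in a slab column `σ c + 1 … σ c + 4` of `c ∈ R`
at the row of the end `v` of a crossing `t` of `c` (as every inserted cell of column `σ c + 1` does), contradiction.
[cite: MadrasSlade1993, §8.2, Theorem 8.2.1 (8.2.13), p. 269] -/
theorem anchor_not_ins (hW : StripWalk T ω n) {s t : ℕ} (hs : s ≤ n) (ht : t < n) (hR : cutOf ω t ∈ R)
    (hx : IsCross ω n (cutOf ω t) t)
    (hcol : colMap (colIdx (ω 0)) R (cutOf ω t) + 1 ≤ ncol ω n R s ∧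
      ncol ω n R s ≤ colMap (colIdx (ω 0)) R (cutOf ω t) + 4)
    (hrow : ncol ω n R s = colMap (colIdx (ω 0)) R (cutOf ω t) + 1 → ω s 1 = ω (vT ω t) 1) : False := by
  have h1 := ncol_not_slab (ω := ω) (n := n) hR s
  have heq : ncol ω n R s = colMap (colIdx (ω 0)) R (cutOf ω t) + 1 := by omega
  obtain ⟨hcs, hint⟩ := interior_of_ncol_eq hR heq
  obtain ⟨hvc, hvR, -, -, -⟩ := cross_v hW ht hx
  have hvn : vT ω t ≤ n := by have := vT_le (ω := ω) t; omega
  have := hW.time_eq hs hvn (by rw [hcs, hvc]) (hrow heq)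
  subst this
  exact not_interior_of_isRight hvR hvc hint

/-- Each block is duplicate-free. [cite: MadrasSlade1993, §8.2, Theorem 8.2.1 (8.2.13), p. 269] -/
theorem nodup_block (hW : StripWalk T ω n) {t : ℕ} (ht : t < n) : (block T R ω n t).Nodup := by
  have hc := (anchor_coords (R := R) hW t).2
  unfold block
  split_ifs with h1 h2 h3 h3
  · refine List.nodup_cons.2 ⟨fun hmem => ?_, nodup_zig _ _ _ _⟩
    have hb := mem_zig_bounds hW.bit hmem
    rw [hc] at hb
    rcases crossing_geometry hW ht h1.1 h1.2 with ⟨-, -, e, -⟩ | ⟨-, -, e, -⟩ <;> omega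
  · refine List.nodup_cons.2 ⟨fun hmem => ?_, List.nodup_reverse.2 (nodup_zig _ _ _ _)⟩
    rw [List.mem_reverse] at hmem
    have hb := mem_zig_bounds hW.bit hmem
    rw [hc] at hb
    rcases crossing_geometry hW ht h1.1 h1.2 with ⟨-, -, e, -⟩ | ⟨-, -, e, -⟩ <;> omega
  · refine List.nodup_cons.2 ⟨fun hmem => ?_, nodup_bridge _ _ _⟩
    obtain ⟨j, hj4, hj⟩ := mem_bridge.1 hmem
    have := congrArg colIdx hj
    rw [hc, colIdx_cellAt hW.bit] at this
    rcases crossing_geometry hW ht h1.1 h1.2 with ⟨-, -, e, -⟩ | ⟨-, -, e, -⟩ <;> omega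
  · refine List.nodup_cons.2 ⟨fun hmem => ?_, List.nodup_reverse.2 (nodup_bridge _ _ _)⟩
    rw [List.mem_reverse] at hmem
    obtain ⟨j, hj4, hj⟩ := mem_bridge.1 hmem
    have := congrArg colIdx hj
    rw [hc, colIdx_cellAt hW.bit] at this
    rcases crossing_geometry hW ht h1.1 h1.2 with ⟨-, -, e, -⟩ | ⟨-, -, e, -⟩ <;> omega
  · exact List.nodup_singleton _

/-- Distinct blocks are disjoint. [cite: MadrasSlade1993, §8.2, Theorem 8.2.1 (8.2.13), p. 269 (statement; slab insertion = the lane's proof)] -/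
theorem disjoint_block (hW : StripWalk T ω n) {t t' : ℕ} (ht : t < n) (ht' : t' < n) (htt : t ≠ t') :
    List.Disjoint (block T R ω n t) (block T R ω n t') := by
  intro z hz hz'
  have hct := (anchor_coords (R := R) hW t)
  have hct' := (anchor_coords (R := R) hW t')
  rcases mem_block hW ht hz with rfl | ⟨hR, hx, -, hcol, hr1, hr2, hr3, -, hr5⟩ <;>
    rcases mem_block hW ht' hz' with h | ⟨hR', hx', -, hcol', hr1', hr2', hr3', -, hr5'⟩
  · exact htt (anchor_inj hW ht.le ht'.le h)
  · rw [hct.2] at hcol' hr5'; rw [hct.1] at hr5'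
    exact anchor_not_ins hW ht.le ht' hR' hx' hcol' fun h => hr5' (Or.inl h)
  · rw [h, hct'.2] at hcol hr5; rw [hct'.1] at hr5
    exact anchor_not_ins hW ht'.le ht hR hx hcol fun h => hr5 (Or.inl h)
  · -- two inserted cells
    by_cases hcc : cutOf ω t = cutOf ω t'
    · have hxT : t ∈ crossTimes ω n (cutOf ω t) := mem_crossTimes.2 ⟨ht, hx⟩
      have hxT' : t' ∈ crossTimes ω n (cutOf ω t) := mem_crossTimes.2 ⟨ht', hcc ▸ hx'⟩
      have hrr : ω (vT ω t) 1 ≠ ω (vT ω t') 1 := fun h => htt (crossTimes_row_inj hW hxT hxT' h)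
      by_cases hT : IsTop ω n (cutOf ω t) t
      · have h1 := hT t' hxT'
        by_cases hT' : IsTop ω n (cutOf ω t') t'
        · have h2 := hT' t (by rw [← hcc]; exact hxT)
          omega
        · have := hr3' hT'; omega
      · have h1 := hr3 hT
        by_cases hT' : IsTop ω n (cutOf ω t') t'
        · have h2 := hT' t (by rw [← hcc]; exact hxT)
          omega
        · have := hr3' hT'; omega
    · rcases lt_or_gt_of_ne hcc with hlt | hlt
      · have := ins_lt_ins (x₀ := colIdx (ω 0)) hR hlt; omega
      · have := ins_lt_ins (x₀ := colIdx (ω 0)) hR' hlt; omega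

/-- The final anchor is in no block. [cite: MadrasSlade1993, §8.2, Theorem 8.2.1 (8.2.13), p. 269] -/
theorem last_not_mem_block (hW : StripWalk T ω n) {t : ℕ} (ht : t < n) : anchor ω n R n ∉ block T R ω n t := by
  intro hz
  have hcn := (anchor_coords (R := R) hW n)
  rcases mem_block hW ht hz with h | ⟨hR, hx, -, hcol, -, -, -, -, hr5⟩
  · have := anchor_inj hW le_rfl ht.le h; omega
  · rw [hcn.2] at hcol hr5; rw [hcn.1] at hr5
    exact anchor_not_ins hW le_rfl ht hR hx hcol fun h => hr5 (Or.inl h)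

/-- **The image list has no repeated point.** [cite: MadrasSlade1993, §8.2, Theorem 8.2.1 (8.2.13), p. 269 (statement; slab insertion = the lane's proof)] -/
theorem nodup_imageList (hW : StripWalk T ω n) : (imageList T R ω n).Nodup := by
  rw [imageList, List.nodup_append]
  refine ⟨?_, List.nodup_singleton _, ?_⟩
  · rw [List.nodup_flatMap]
    refine ⟨fun t ht => nodup_block hW (List.mem_range.1 ht), ?_⟩
    exact List.pairwise_lt_range.imp_of_mem fun {t t'} ht ht' hlt =>
      disjoint_block hW (List.mem_range.1 ht) (List.mem_range.1 ht') hlt.ne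
  · intro z hz z' hz' hzz
    rw [List.mem_singleton] at hz'
    subst hzz; subst hz'
    obtain ⟨t, ht, hzt⟩ := List.mem_flatMap.1 hz
    exact last_not_mem_block hW (List.mem_range.1 ht) hzt

/-! ### The image list is a brick chain -/

/-- The anchor of a site as a cell of the slanted frame. [cite: MadrasSlade1993, §8.2, Theorem 8.2.1 (8.2.13), p. 269] -/
theorem anchor_eq (t : ℕ) : anchor ω n R t = cellAt (cosetBit (ω 0)) (ncol ω n R t) (ω t 1) := rfl

/-- Each block is a brick chain. [cite: MadrasSlade1993, §8.2, Theorem 8.2.1 (8.2.13), p. 269] -/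
theorem isChain_block (hW : StripWalk T ω n) {t : ℕ} (ht : t < n) : (block T R ω n t).IsChain brickGraph.Adj := by
  unfold block
  split_ifs with h1 h2 h3 h3
  · rcases crossing_geometry hW ht h1.1 h1.2 with ⟨-, hv, hu, -, hrow⟩ | ⟨hlt, -⟩
    · rw [List.isChain_cons]
      refine ⟨fun y hy => ?_, isChain_zig _ _ _ _⟩
      rw [head?_zig, Option.mem_def, Option.some.injEq] at hy
      subst hy
      rw [anchor_eq, adj_cellAt_iff, hu, hv]
      omega
    · exfalso; omega
  · rcases crossing_geometry hW ht h1.1 h1.2 with ⟨hlt, -⟩ | ⟨-, hv, hu, -, hrow⟩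
    · exfalso; omega
    · rw [List.isChain_cons]
      refine ⟨fun y hy => ?_, isChain_reverse_zig _ _ _ _⟩
      rw [head?_reverse_zig, Option.mem_def, Option.some.injEq] at hy
      subst hy
      rw [anchor_eq, adj_cellAt_iff, hu, hv]
      omega
  · rcases crossing_geometry hW ht h1.1 h1.2 with ⟨-, hv, hu, -, hrow⟩ | ⟨hlt, -⟩
    · rw [List.isChain_cons]
      refine ⟨fun y hy => ?_, isChain_bridge _ _ _⟩
      rw [head?_bridge, Option.mem_def, Option.some.injEq] at hy
      subst hy
      rw [anchor_eq, adj_cellAt_iff, hu, hv]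
      omega
    · exfalso; omega
  · rcases crossing_geometry hW ht h1.1 h1.2 with ⟨hlt, -⟩ | ⟨-, hv, hu, -, hrow⟩
    · exfalso; omega
    · rw [List.isChain_cons]
      refine ⟨fun y hy => ?_, isChain_reverse_bridge _ _ _⟩
      rw [head?_reverse_bridge, Option.mem_def, Option.some.injEq] at hy
      subst hy
      rw [anchor_eq, adj_cellAt_iff, hu, hv]
      omega
  · exact List.isChain_singleton _

/-- The last point of the block of step `t` is adjacent to the next anchor. [cite: MadrasSlade1993, §8.2, Theorem 8.2.1 (8.2.13), p. 269] -/
theorem getLast_block_adj (hW : StripWalk T ω n) {t : ℕ} (ht : t < n) :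
    ∀ z ∈ (block T R ω n t).getLast?, brickGraph.Adj z (anchor ω n R (t + 1)) := by
  intro z hz
  unfold block at hz
  split_ifs at hz with h1 h2 h3 h3
  · rcases crossing_geometry hW ht h1.1 h1.2 with ⟨-, hv, -, hv', hrow⟩ | ⟨hlt, -⟩
    · rw [List.getLast?_cons, getLast?_zig] at hz
      simp only [Option.getD_some, Option.mem_def, Option.some.injEq] at hz
      subst hz
      rw [anchor_eq, adj_cellAt_iff, hv', hv]
      omega
    · exfalso; omega
  · rcases crossing_geometry hW ht h1.1 h1.2 with ⟨hlt, -⟩ | ⟨-, hv, -, hu, hrow⟩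
    · exfalso; omega
    · rw [List.getLast?_cons, getLast?_reverse_zig] at hz
      simp only [Option.getD_some, Option.mem_def, Option.some.injEq] at hz
      subst hz
      rw [anchor_eq, adj_cellAt_iff, hu, hv]
      omega
  · rcases crossing_geometry hW ht h1.1 h1.2 with ⟨-, hv, -, hv', hrow⟩ | ⟨hlt, -⟩
    · rw [List.getLast?_cons, getLast?_bridge] at hz
      simp only [Option.getD_some, Option.mem_def, Option.some.injEq] at hz
      subst hz
      rw [anchor_eq, adj_cellAt_iff, hv', hv]
      omega
    · exfalso; omega
  · rcases crossing_geometry hW ht h1.1 h1.2 with ⟨hlt, -⟩ | ⟨-, hv, -, hu, hrow⟩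
    · exfalso; omega
    · rw [List.getLast?_cons, getLast?_reverse_bridge] at hz
      simp only [Option.getD_some, Option.mem_def, Option.some.injEq] at hz
      subst hz
      rw [anchor_eq, adj_cellAt_iff, hu, hv]
      omega
  · simp only [List.getLast?_singleton, Option.mem_def, Option.some.injEq] at hz
    subst hz
    have hd := ncol_sub_eq_of_not hW ht h1
    have hs := hW.step ht
    rw [anchor_eq, anchor_eq, adj_cellAt_iff]
    omega

/-- Gluing the blocks: the concatenation of the blocks `0 … m-1` (`m ≤ n`) is a chain whose last point is adjacent to
the anchor of `m`. [cite: MadrasSlade1993, §8.2, Theorem 8.2.1 (8.2.13), p. 269] -/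
theorem isChain_flatMap_blocks (hW : StripWalk T ω n) :
    ∀ m ≤ n, ((List.range m).flatMap (block T R ω n)).IsChain brickGraph.Adj ∧
      ∀ z ∈ ((List.range m).flatMap (block T R ω n)).getLast?, brickGraph.Adj z (anchor ω n R m)
  | 0, _ => by simp
  | m + 1, hm => by
    obtain ⟨ih1, ih2⟩ := isChain_flatMap_blocks hW m (by omega)
    rw [List.range_succ, List.flatMap_append, List.flatMap_singleton]
    refine ⟨List.IsChain.append ih1 (isChain_block hW (by omega)) fun z hz y hy => ?_, ?_⟩
    · rw [head?_block, Option.mem_def, Option.some.injEq] at hy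
      subst hy
      exact ih2 z hz
    · intro z hz
      rw [List.getLast?_append] at hz
      obtain ⟨w, hw⟩ := List.getLast?_isSome.2 (block_ne_nil T R ω n m) |> Option.isSome_iff_exists.1
      rw [hw, Option.some_or, Option.mem_def, Option.some.injEq] at hz
      subst hz
      exact getLast_block_adj hW (by omega) w (by rw [hw]; rfl)

/-- **The image list is a brick chain.** [cite: MadrasSlade1993, §8.2, Theorem 8.2.1 (8.2.13), p. 269 (statement; slab insertion = the lane's proof)] -/
theorem isChain_imageList (hW : StripWalk T ω n) : (imageList T R ω n).IsChain brickGraph.Adj := by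
  obtain ⟨h1, h2⟩ := isChain_flatMap_blocks (R := R) hW n le_rfl
  exact List.IsChain.append h1 (List.isChain_singleton _) fun z hz y hy => by
    rw [List.head?_cons, Option.mem_def, Option.some.injEq] at hy
    subst hy; exact h2 z hz

/-- The image list starts at the start of the walk. [cite: MadrasSlade1993, §8.2, Theorem 8.2.1 (8.2.13), p. 269] -/
theorem head?_imageList (T : ℕ) (R : Finset ℤ) (ω : ℕ → Site 2) (n : ℕ) :
    (imageList T R ω n).head? = some (ω 0) := by
  rw [← anchor_zero (ω := ω) (n := n) (R := R)]
  unfold imageList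
  cases n with
  | zero => simp
  | succ n =>
    rw [List.range_succ_eq_map, List.flatMap_cons, List.append_assoc, List.head?_append,
      head?_block, Option.some_or]

/-- All points of the image list lie in the rows `0 … T+1`. [cite: MadrasSlade1993, §8.2, Theorem 8.2.1 (8.2.13), p. 269] -/
theorem row_mem_imageList (hW : StripWalk T ω n) {z : Site 2} (hz : z ∈ imageList T R ω n) :
    0 ≤ z 1 ∧ z 1 ≤ (T : ℤ) + 1 := by
  rw [imageList, List.mem_append, List.mem_flatMap, List.mem_singleton] at hz
  rcases hz with ⟨t, ht, hzt⟩ | rfl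
  · exact row_mem_block hW (List.mem_range.1 ht) hzt
  · rw [(anchor_coords (R := R) hW n).1]
    exact ⟨hW.row_nonneg n le_rfl, by have := hW.row_le n le_rfl; omega⟩

/-- Every point of the image list is an anchor or an inserted cell of a block. [cite: MadrasSlade1993, §8.2, Theorem 8.2.1 (8.2.13), p. 269] -/
theorem mem_imageList {z : Site 2} (hz : z ∈ imageList T R ω n) :
    (∃ t ≤ n, z = anchor ω n R t) ∨ ∃ t < n, z ∈ block T R ω n t ∧ z ≠ anchor ω n R t := by
  rw [imageList, List.mem_append, List.mem_flatMap, List.mem_singleton] at hz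
  rcases hz with ⟨t, ht, hzt⟩ | rfl
  · by_cases h : z = anchor ω n R t
    · exact Or.inl ⟨t, (List.mem_range.1 ht).le, h⟩
    · exact Or.inr ⟨t, List.mem_range.1 ht, hzt, h⟩
  · exact Or.inl ⟨n, le_rfl, rfl⟩

/-- Every anchor is a point of the image list. [cite: MadrasSlade1993, §8.2, Theorem 8.2.1 (8.2.13), p. 269] -/
theorem anchor_mem_imageList {t : ℕ} (ht : t ≤ n) : anchor ω n R t ∈ imageList T R ω n := by
  rw [imageList, List.mem_append, List.mem_flatMap, List.mem_singleton]
  rcases Nat.lt_or_ge t n with h | h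
  · refine Or.inl ⟨t, List.mem_range.2 h, ?_⟩
    obtain ⟨rest, hrest⟩ := block_eq_cons T R ω n t
    rw [hrest]; exact List.mem_cons_self
  · have : t = n := by omega
    subst this; exact Or.inr rfl

/-! ### Length of the image and the cost of a cut -/

/-- The length of a block: `1 +` the extra length of a crossing of a cut of `R`. [cite: MadrasSlade1993, §8.2, Theorem 8.2.1 (8.2.13), p. 269] -/
theorem length_block (T : ℕ) (R : Finset ℤ) (ω : ℕ → Site 2) (n t : ℕ) :
    (block T R ω n t).length =
      1 + if cutOf ω t ∈ R ∧ IsCross ω n (cutOf ω t) t then extra T ω n (cutOf ω t) t else 0 := by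
  unfold block extra
  split_ifs <;> simp [length_zig, length_bridge] <;> omega

/-- The crossing times of `c ∈ R` are the steps flagged by the blocks with `cutOf = c`. [cite: MadrasSlade1993, §8.2, Theorem 8.2.1 (8.2.13), p. 269] -/
theorem crossTimes_eq_filter (hW : StripWalk T ω n) {c : ℤ} (hc : c ∈ R) :
    crossTimes ω n c =
      (Finset.range n).filter fun t => (cutOf ω t ∈ R ∧ IsCross ω n (cutOf ω t) t) ∧ cutOf ω t = c := by
  ext t
  rw [mem_crossTimes, Finset.mem_filter, Finset.mem_range]
  constructor
  · rintro ⟨ht, hx⟩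
    obtain ⟨-, -, hcut, -⟩ := cross_v hW ht hx
    exact ⟨ht, ⟨hcut.symm ▸ hc, hcut.symm ▸ hx⟩, hcut⟩
  · rintro ⟨ht, ⟨-, hx⟩, hcut⟩
    exact ⟨ht, hcut ▸ hx⟩

/-- **Length of the image**: `|Ψ(ω,R)| = n + Σ_{c ∈ R} cost(c)` steps. [cite: MadrasSlade1993, §8.2, Theorem 8.2.1 (8.2.13), p. 269 (statement; slab insertion = the lane's proof)] -/
theorem length_imageList (hW : StripWalk T ω n) :
    (imageList T R ω n).length = n + 1 + ∑ c ∈ R, cost T ω n c := by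
  rw [imageList, List.length_append, List.length_singleton, List.length_flatMap, list_sum_map_range]
  simp_rw [length_block]
  rw [Finset.sum_add_distrib, Finset.sum_const, Finset.card_range, smul_eq_mul, mul_one, ← Finset.sum_filter]
  have hmaps : ∀ t ∈ (Finset.range n).filter (fun t => cutOf ω t ∈ R ∧ IsCross ω n (cutOf ω t) t),
      cutOf ω t ∈ R := fun t ht => (Finset.mem_filter.1 ht).2.1
  rw [← Finset.sum_fiberwise_of_maps_to hmaps]
  have hinner : ∀ c ∈ R,
      ∑ t ∈ ((Finset.range n).filter (fun t => cutOf ω t ∈ R ∧ IsCross ω n (cutOf ω t) t)).filter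
          (fun t => cutOf ω t = c), extra T ω n (cutOf ω t) t = cost T ω n c := by
    intro c hc
    rw [cost, crossTimes_eq_filter hW hc, Finset.filter_filter]
    refine Finset.sum_congr rfl fun t ht => ?_
    rw [(Finset.mem_filter.1 ht).2.2]
  rw [Finset.sum_congr rfl hinner]
  ring

/-- The number of crossings of a cut is at most `(top row) + 1`: distinct crossings have their ends `v` in distinct
rows of `{0, …, top}`. [cite: MadrasSlade1993, §8.2, Theorem 8.2.1 (8.2.13), p. 269] -/
theorem card_crossTimes_le (hW : StripWalk T ω n) {c : ℤ} {s : ℕ} (hs : s ∈ crossTimes ω n c)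
    (htop : IsTop ω n c s) : (crossTimes ω n c).card ≤ (ω (vT ω s) 1).toNat + 1 := by
  have hvn : ∀ t ∈ crossTimes ω n c, vT ω t ≤ n := fun t ht => by
    have := vT_le (ω := ω) t; have := (mem_crossTimes.1 ht).1; omega
  have h := Finset.card_le_card_of_injOn (s := crossTimes ω n c) (t := Finset.range ((ω (vT ω s) 1).toNat + 1))
    (fun t => (ω (vT ω t) 1).toNat) (fun t ht => ?_) (fun t ht t' ht' h => ?_)
  · simpa using h
  · have h1 := htop t ht
    have h0 := hW.row_nonneg _ (hvn t ht)
    have h0' := hW.row_nonneg _ (hvn s hs)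
    simp only [Finset.coe_range, Set.mem_Iio]
    omega
  · have h0 := hW.row_nonneg _ (hvn t ht)
    have h0' := hW.row_nonneg _ (hvn t' ht')
    exact crossTimes_row_inj hW ht ht' (by simp only at h; omega)

/-- **Cost bound**: each cut costs at most `4T + 6` extra steps (`4` per crossing below the top one — at most `Y*`
of them —, `2(T − Y*) + 6` for the top one). [cite: MadrasSlade1993, §8.2, Theorem 8.2.1 (8.2.13), p. 269 (statement; slab insertion = the lane's proof)] -/
theorem cost_le (hW : StripWalk T ω n) (c : ℤ) : cost T ω n c ≤ 4 * T + 6 := by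
  by_cases hc : (crossTimes ω n c).Nonempty
  · obtain ⟨s, hs, htop⟩ := exists_isTop hc
    have huniq : ∀ t ∈ crossTimes ω n c, t ≠ s → ¬ IsTop ω n c t := by
      intro t ht hts h
      exact hts (crossTimes_row_inj hW ht hs (le_antisymm (htop t ht) (h s hs)))
    rw [cost, ← Finset.add_sum_erase _ _ hs]
    have h2 : ∑ t ∈ (crossTimes ω n c).erase s, extra T ω n c t = 4 * ((crossTimes ω n c).card - 1) := by
      rw [Finset.sum_congr rfl fun t ht => ?_, Finset.sum_const, Finset.card_erase_of_mem hs, smul_eq_mul,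
        mul_comm]
      rw [extra, if_neg (huniq t (Finset.mem_of_mem_erase ht) (Finset.ne_of_mem_erase ht))]
    rw [h2, extra, if_pos htop]
    have hk := card_crossTimes_le hW hs htop
    have hvn : vT ω s ≤ n := by have := vT_le (ω := ω) s; have := (mem_crossTimes.1 hs).1; omega
    have hL := hW.row_le _ hvn
    have h0 := hW.row_nonneg _ hvn
    have : (ω (vT ω s) 1).toNat ≤ T := by omega
    have hpos : 1 ≤ (crossTimes ω n c).card := Finset.card_pos.2 ⟨s, hs⟩
    omega
  · rw [Finset.not_nonempty_iff_eq_empty] at hc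
    rw [cost, hc, Finset.sum_empty]; omega

/-! ### From vertex lists to the vertex functions of `brickSaws` -/

/-- A duplicate-free brick chain, read as a vertex function translated to the origin, is a walk of `brickSaws`.
[cite: MadrasSlade1993, §1.1, p. 1 (self-avoiding walks as vertex functions)] -/
theorem ofList_sub_mem_brickSaws {l : List (Site 2)} (hl : l ≠ []) (hN : l.Nodup)
    (hC : l.IsChain brickGraph.Adj) (p : Site 2) (hp : l.head? = some p) :
    (fun s => ofList l s - p) ∈ brickSaws (l.length - 1) := by
  have hlen : 0 < l.length := List.length_pos_of_ne_nil hl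
  have hp' : l[0] = p := by
    rw [← List.head_eq_getElem hl]; exact Option.some.inj ((List.head?_eq_some_head hl).symm.trans hp)
  refine mem_brickSaws.2 ⟨?_, ?_, ?_, ?_⟩
  · show ofList l 0 - p = 0
    rw [ofList_eq_getElem hlen, hp', sub_self]
  · intro i hi
    show ofList l i - p = ofList l (l.length - 1) - p
    rw [ofList_eq_getLast hl hi, ofList_eq_getLast hl le_rfl]
  · intro i hi
    show brickGraph.Adj (ofList l i - p) (ofList l (i + 1) - p)
    rw [brickGraph_adj_sub_right, ofList_eq_getElem (by omega), ofList_eq_getElem (by omega)]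
    exact List.isChain_iff_getElem.1 hC i (by omega)
  · intro i hi j hj hij
    simp only [Set.mem_setOf_eq] at hi hj
    have h' : ofList l i = ofList l j := sub_left_inj.1 hij
    rw [ofList_eq_getElem (by omega), ofList_eq_getElem (by omega)] at h'
    exact (hN.getElem_inj_iff).1 h'

/-- A vertex function belongs to at most one `brickSaws m`. [cite: MadrasSlade1993, §1.1, p. 1] -/
theorem eq_of_mem_brickSaws_of_mem {m m' : ℕ} {υ : ℕ → Site 2} (h : υ ∈ brickSaws m) (h' : υ ∈ brickSaws m') :
    m = m' := by
  obtain ⟨-, he, -, hi⟩ := mem_brickSaws.1 h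
  obtain ⟨-, he', -, hi'⟩ := mem_brickSaws.1 h'
  by_contra hne
  rcases lt_or_gt_of_ne hne with hlt | hlt
  · have := hi' (show m ≤ m' by omega) (show m + 1 ≤ m' by omega) (he (m + 1) (by omega)).symm
    omega
  · have := hi (show m' ≤ m by omega) (show m' + 1 ≤ m by omega) (he' (m' + 1) (by omega)).symm
    omega

/-! ### The image walk `Ψ(ω, R)` -/

/-- `Ψ(ω,R)` as a vertex function from the origin. [cite: MadrasSlade1993, §8.2, Theorem 8.2.1 (8.2.13), p. 269 (statement; slab insertion = the lane's proof)] -/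
def psi (T : ℕ) (R : Finset ℤ) (ω : ℕ → Site 2) (n : ℕ) : ℕ → Site 2 :=
  fun s => ofList (imageList T R ω n) s - ω 0

/-- The image list is non-empty. [cite: MadrasSlade1993, §8.2, Theorem 8.2.1 (8.2.13), p. 269] -/
theorem imageList_ne_nil (T : ℕ) (R : Finset ℤ) (ω : ℕ → Site 2) (n : ℕ) : imageList T R ω n ≠ [] := by
  simp [imageList]

/-- **`Ψ(ω,R)` is a self-avoiding walk of `𝕋`** of length `|imageList| - 1` from the origin whose translate by `ω 0`
stays in the strip of height `T + 1`. [cite: MadrasSlade1993, §8.2, Theorem 8.2.1 (8.2.13), p. 269 (statement; slab insertion = the lane's proof)] -/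
theorem psi_spec (hW : StripWalk T ω n) :
    psi T R ω n ∈ brickSaws ((imageList T R ω n).length - 1) ∧
      ∀ m ≤ (imageList T R ω n).length - 1, InStrip (T + 1) (ω 0 + psi T R ω n m) := by
  refine ⟨ofList_sub_mem_brickSaws (imageList_ne_nil T R ω n) (nodup_imageList hW) (isChain_imageList hW)
    (ω 0) (head?_imageList T R ω n), fun m _ => ?_⟩
  have e : ω 0 + psi T R ω n m = ofList (imageList T R ω n) m := by simp [psi]
  rw [e]
  have := row_mem_imageList hW (ofList_mem (imageList_ne_nil T R ω n) m)
  exact ⟨this.1, by push_cast; exact this.2⟩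

/-! ### Injectivity: recovering `ω` from the image (given `R`) -/

section Good

open Classical in
/-- The Boolean test "`z` is a moved site": its column is in no pure slab column `σ c + 2 … σ c + 4`, and if it is
in a column `σ c + 1` then its translate by one slab `z + (8, 0)` is not an image point (for the vacated cell of a
crossing that translate is the anchor of the end `v`). [cite: MadrasSlade1993, §8.2, Theorem 8.2.1 (8.2.13), p. 269 (statement; slab insertion = the lane's proof)] -/
def isGood (S : Finset (Site 2)) (x₀ : ℤ) (R : Finset ℤ) (z : Site 2) : Bool :=
  decide (¬ ∃ c ∈ R, (colMap x₀ R c + 2 ≤ colIdx z ∧ colIdx z ≤ colMap x₀ R c + 4) ∨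
    (colIdx z = colMap x₀ R c + 1 ∧ z + mk 8 0 ∈ S))

/-- The translate by one slab of a cell. [cite: Grimmett2018, §5.5] -/
theorem cellAt_add_slab (r i Y : ℤ) : cellAt r i Y + mk 8 0 = cellAt r (i + 4) Y := by
  unfold cellAt
  funext j; fin_cases j
  · show (2 * i + Y + r) + 8 = 2 * (i + 4) + Y + r; ring
  · show Y + 0 = Y; ring

open Classical in
/-- **Anchors pass the test.** [cite: MadrasSlade1993, §8.2, Theorem 8.2.1 (8.2.13), p. 269] -/
theorem isGood_anchor (hW : StripWalk T ω n) {t : ℕ} (ht : t ≤ n) :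
    isGood (imageList T R ω n).toFinset (colIdx (ω 0)) R (anchor ω n R t) = true := by
  unfold isGood
  rw [decide_eq_true_iff]
  rintro ⟨c, hc, h⟩
  rw [(anchor_coords (R := R) hW t).2] at h
  rcases h with h | ⟨hcol, hmem⟩
  · exact ncol_not_slab hc t h
  · obtain ⟨hct, hint⟩ := interior_of_ncol_eq hc hcol
    rw [List.mem_toFinset, anchor_eq, cellAt_add_slab] at hmem
    have h5 := colMap_succ_of_mem (x₀ := colIdx (ω 0)) hc
    -- the translate is an image point of column `σ (c+1)` and row `ω t 1`: an anchor of a non-interior site of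
    -- column `c + 1` in the same row, i.e. of `t` itself
    rcases mem_imageList hmem with ⟨s, hs, hse⟩ | ⟨s, hs, hsb, hsne⟩
    · rw [anchor_eq, cellAt_inj] at hse
      have hI := ncol_mem_Ioc (R := R) (ω := ω) (n := n) s
      have hcs : colIdx (ω s) = c + 1 :=
        (eq_of_mem_Ioc (x₀ := colIdx (ω 0)) (R := R) (x := ncol ω n R s) (by rw [add_sub_cancel_right]; omega)
          (by omega) hI.1 hI.2).symm
      have hst : s = t := hW.time_eq hs ht (by rw [hcs, hct]) (by omega)
      subst hst
      have := ncol_eq_of_interior (R := R) (by rw [hct, add_sub_cancel_right]; exact hc)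
        (by rw [hct, add_sub_cancel_right]; exact hint)
      omega
    · rcases mem_block hW hs hsb with hse | ⟨hR', -, -, hcol', -⟩
      · exact hsne hse
      · rw [colIdx_cellAt hW.bit] at hcol'
        exact colMap_not_ins (x₀ := colIdx (ω 0)) hR' (c + 1) (by rw [h5]; omega)

open Classical in
/-- **Inserted cells fail the test.** [cite: MadrasSlade1993, §8.2, Theorem 8.2.1 (8.2.13), p. 269] -/
theorem isGood_eq_false (hW : StripWalk T ω n) {t : ℕ} (ht : t < n) {z : Site 2} (hz : z ∈ block T R ω n t)
    (hne : z ≠ anchor ω n R t) : isGood (imageList T R ω n).toFinset (colIdx (ω 0)) R z = false := by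
  unfold isGood
  rw [decide_eq_false_iff_not, not_not]
  rcases mem_block hW ht hz with h | ⟨hR, hx, hcell, hcol, -, -, -, -, hr5⟩
  · exact absurd h hne
  refine ⟨cutOf ω t, hR, ?_⟩
  by_cases h1 : colIdx z = colMap (colIdx (ω 0)) R (cutOf ω t) + 1
  · right
    refine ⟨h1, ?_⟩
    rw [List.mem_toFinset, hcell, cellAt_add_slab, h1, hr5 (Or.inl h1)]
    -- this is the anchor of the end `v` of the crossing
    have hgeo := crossing_geometry hW ht hR hx
    have hvn : vT ω t ≤ n := by have := vT_le (ω := ω) t; omega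
    have e : cellAt (cosetBit (ω 0)) (colMap (colIdx (ω 0)) R (cutOf ω t) + 1 + 4) (ω (vT ω t) 1) =
        anchor ω n R (vT ω t) := by
      rw [anchor_eq, cellAt_inj]
      rcases hgeo with ⟨-, hv, -, hv', -⟩ | ⟨-, hv, hv', -, -⟩ <;> (rw [hv]; constructor <;> omega)
    rw [e]
    exact anchor_mem_imageList hvn
  · left; omega

/-- Filtering a block leaves its anchor. [cite: MadrasSlade1993, §8.2, Theorem 8.2.1 (8.2.13), p. 269] -/
theorem filter_good_block (hW : StripWalk T ω n) {t : ℕ} (ht : t < n) :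
    (block T R ω n t).filter (isGood (imageList T R ω n).toFinset (colIdx (ω 0)) R) = [anchor ω n R t] := by
  obtain ⟨rest, hrest⟩ := block_eq_cons T R ω n t
  have hbad : ∀ z ∈ rest, ¬ isGood (imageList T R ω n).toFinset (colIdx (ω 0)) R z = true := by
    intro z hz
    have hz' : z ∈ block T R ω n t := by rw [hrest]; exact List.mem_cons_of_mem _ hz
    have hnd := nodup_block (R := R) hW ht
    rw [hrest, List.nodup_cons] at hnd
    have hne : z ≠ anchor ω n R t := fun h => hnd.1 (h ▸ hz)
    rw [isGood_eq_false hW ht hz' hne]; exact Bool.false_ne_true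
  rw [hrest, List.filter_cons_of_pos (isGood_anchor hW ht.le), List.filter_eq_nil_iff.2 hbad]

/-- **Recovering the anchors**: the image points passing the test are exactly the anchors, in order.
[cite: MadrasSlade1993, §8.2, Theorem 8.2.1 (8.2.13), p. 269 (statement; slab insertion = the lane's proof)] -/
theorem filter_good_imageList (hW : StripWalk T ω n) :
    (imageList T R ω n).filter (isGood (imageList T R ω n).toFinset (colIdx (ω 0)) R) =
      (List.range (n + 1)).map fun t => anchor ω n R t := by
  set S := (imageList T R ω n).toFinset with hS
  have hb : ∀ t < n, (block T R ω n t).filter (isGood S (colIdx (ω 0)) R) = [anchor ω n R t] := fun t ht => by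
    rw [hS]; exact filter_good_block hW ht
  have hn : isGood S (colIdx (ω 0)) R (anchor ω n R n) = true := by rw [hS]; exact isGood_anchor hW le_rfl
  rw [imageList, List.filter_append, List.filter_flatMap,
    List.flatMap_congr fun t ht => hb t (List.mem_range.1 ht),
    ← List.map_eq_flatMap, List.filter_cons_of_pos hn,
    List.filter_nil, List.range_succ, List.map_append, List.map_singleton]

end Good

/-! ### Injectivity: recovering `R` from the image -/

/-- The columns of the points of a list in the top row `T + 1`. [cite: MadrasSlade1993, §8.2, Theorem 8.2.1 (8.2.13), p. 269] -/
def tallCols (T : ℕ) (l : List (Site 2)) : Finset ℤ :=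
  (l.toFinset.filter fun z => z 1 = (T : ℤ) + 1).image fun z => colIdx z

/-- Membership in `tallCols`. [cite: MadrasSlade1993, §8.2, Theorem 8.2.1 (8.2.13), p. 269] -/
theorem mem_tallCols {l : List (Site 2)} {y : ℤ} :
    y ∈ tallCols T l ↔ ∃ z ∈ l, z 1 = (T : ℤ) + 1 ∧ colIdx z = y := by
  classical
  simp [tallCols, and_assoc]

/-- **The tall columns of the image are exactly the tall inserted columns** (every cut of `R` having a crossing).
[cite: MadrasSlade1993, §8.2, Theorem 8.2.1 (8.2.13), p. 269 (statement; slab insertion = the lane's proof)] -/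
theorem tallCols_imageList (hW : StripWalk T ω n) (hR : ∀ c ∈ R, (crossTimes ω n c).Nonempty) :
    tallCols T (imageList T R ω n) = tallIns (colIdx (ω 0)) R := by
  ext y
  rw [mem_tallCols, mem_tallIns]
  constructor
  · rintro ⟨z, hz, hz1, rfl⟩
    rcases mem_imageList hz with ⟨t, ht, rfl⟩ | ⟨t, ht, hzb, hne⟩
    · rw [(anchor_coords (R := R) hW t).1] at hz1
      have := hW.row_le t ht; omega
    · rcases mem_block hW ht hzb with h | ⟨hRc, -, -, -, -, -, -, htop, -⟩
      · exact absurd h hne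
      · have := htop hz1
        exact ⟨_, hRc, by omega⟩
  · rintro ⟨c, hc, hy⟩
    obtain ⟨s, hs, htop⟩ := exists_isTop (hR c hc)
    obtain ⟨hsn, hsc⟩ := mem_crossTimes.1 hs
    obtain ⟨-, -, hcut, -, -⟩ := cross_v hW hsn hsc
    have hvn : vT ω s ≤ n := by have := vT_le (ω := ω) s; omega
    have e := hW.row_add hvn
    -- the block of the top crossing contains the two top cells of the detour
    have hzig : ∀ z ∈ zig (cosetBit (ω 0)) (colMap (colIdx (ω 0)) R c) (ω (vT ω s) 1) (T - (ω (vT ω s) 1).toNat),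
        z ∈ block T R ω n s := by
      intro z hz
      unfold block
      rw [if_pos ⟨hcut.symm ▸ hc, hcut.symm ▸ hsc⟩, hcut, if_pos htop]
      refine List.mem_cons_of_mem _ ?_
      split_ifs
      · exact hz
      · exact List.mem_reverse.2 hz
    have hmem : ∀ z ∈ block T R ω n s, z ∈ imageList T R ω n := fun z hz => by
      rw [imageList, List.mem_append, List.mem_flatMap]
      exact Or.inl ⟨s, List.mem_range.2 hsn, hz⟩
    obtain ⟨j, hj2, hj3, hyj⟩ : ∃ j : ℕ, 2 ≤ j ∧ j ≤ 3 ∧ y = colMap (colIdx (ω 0)) R c + (j : ℤ) := by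
      rcases hy with h | h
      · exact ⟨2, le_rfl, by norm_num, by simpa using h⟩
      · exact ⟨3, by norm_num, le_rfl, by simpa using h⟩
    refine ⟨cellAt (cosetBit (ω 0)) (colMap (colIdx (ω 0)) R c + (j : ℤ))
        (ω (vT ω s) 1 + ((T - (ω (vT ω s) 1).toNat : ℕ) : ℤ) + 1),
      hmem _ (hzig _ (top_mem_zig _ _ _ _ hj2 hj3)), ?_, ?_⟩
    · simp only [cellAt_one]; omega
    · rw [colIdx_cellAt hW.bit]; exact hyj.symm

/-- **Injectivity of `(ω, R) ↦ Ψ(ω, R)`** on strip walks from the same start with every chosen cut crossed (list form).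
[cite: MadrasSlade1993, §8.2, Theorem 8.2.1 (8.2.13), p. 269 (statement; slab insertion = the lane's proof)] -/
theorem imageList_inj {ω' : ℕ → Site 2} {R' : Finset ℤ} (hW : StripWalk T ω n) (hW' : StripWalk T ω' n)
    (h0 : ω 0 = ω' 0) (hR : ∀ c ∈ R, (crossTimes ω n c).Nonempty) (hR' : ∀ c ∈ R', (crossTimes ω' n c).Nonempty)
    (h : imageList T R ω n = imageList T R' ω' n) : R = R' ∧ ∀ t ≤ n, ω t = ω' t := by
  classical
  have hx0 : colIdx (ω 0) = colIdx (ω' 0) := by rw [h0]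
  have hRR : R = R' := by
    apply tallIns_injective (x₀ := colIdx (ω 0))
    rw [← tallCols_imageList hW hR, h, hx0, ← tallCols_imageList hW' hR']
  subst hRR
  refine ⟨rfl, fun t ht => ?_⟩
  have hf := filter_good_imageList (R := R) hW
  rw [h, hx0, filter_good_imageList hW'] at hf
  have ha := List.map_inj_left.1 hf.symm t (List.mem_range.2 (Nat.lt_succ_of_le ht))
  rw [anchor_eq, anchor_eq, h0, cellAt_inj] at ha
  have hI := ncol_mem_Ioc (R := R) (ω := ω) (n := n) t
  have hI' := ncol_mem_Ioc (R := R) (ω := ω') (n := n) t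
  rw [ha.1, hx0] at hI
  have hc : colIdx (ω t) = colIdx (ω' t) := eq_of_mem_Ioc hI.1 hI.2 hI'.1 hI'.2
  exact eq_of_colIdx_eq hc ha.2 (by rw [hW.cosetBit_eq t ht, hW'.cosetBit_eq t ht, h0])

/-- **Injectivity of `Ψ`** (function form): equal images force `R = R'` and `ω = ω'` on `[0, n]`.
[cite: MadrasSlade1993, §8.2, Theorem 8.2.1 (8.2.13), p. 269 (statement; slab insertion = the lane's proof)] -/
theorem psi_inj {ω' : ℕ → Site 2} {R' : Finset ℤ} (hW : StripWalk T ω n) (hW' : StripWalk T ω' n)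
    (h0 : ω 0 = ω' 0) (hR : ∀ c ∈ R, (crossTimes ω n c).Nonempty) (hR' : ∀ c ∈ R', (crossTimes ω' n c).Nonempty)
    (hlen : (imageList T R ω n).length = (imageList T R' ω' n).length)
    (h : psi T R ω n = psi T R' ω' n) : R = R' ∧ ∀ t ≤ n, ω t = ω' t := by
  refine imageList_inj hW hW' h0 hR hR' (ofList_inj hlen fun s => ?_)
  have := congrFun h s
  simp only [psi, h0] at this
  exact sub_left_inj.1 this

/-! ### From `TriStrip.stripPairs` to strip walks -/

/-- The placed walk of a pair of `stripPairs T n` is a strip walk from its starting site. [cite: MadrasSlade1993, §8.2, eq. (8.2.1), p. 267] -/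
theorem stripWalk_of_mem {p : Site 2 × (ℕ → Site 2)} (hp : p ∈ stripPairs T n) :
    StripWalk T (fun t => p.1 + p.2 t) n ∧ p.1 + p.2 0 = p.1 := by
  obtain ⟨-, hυ, hin⟩ := mem_stripPairs.1 hp
  obtain ⟨h0, -, hadj, hinj⟩ := mem_brickSaws.1 hυ
  refine ⟨⟨fun t ht => ?_, fun t ht t' ht' h => hinj ht ht' (add_left_cancel h), fun t ht => (hin t ht).1,
    fun t ht => (hin t ht).2⟩, by simp [h0]⟩
  have h := hadj t ht
  rw [← brickGraph_adj_add_right (p.2 t) (p.2 (t + 1)) p.1, add_comm (p.2 t), add_comm (p.2 (t + 1))] at h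
  exact h

/-- An admissible cut of a placed walk has a crossing. [cite: MadrasSlade1993, §8.2, Theorem 8.2.1 (8.2.13), p. 269] -/
theorem crossTimes_nonempty_of_mem_triCuts {p : Site 2 × (ℕ → Site 2)} {c : ℤ} (hc : c ∈ triCuts p.1 p.2 n) :
    (crossTimes (fun t => p.1 + p.2 t) n c).Nonempty := by
  obtain ⟨⟨s, hs, hsc⟩, ⟨s', hs', hsc'⟩⟩ := mem_triCuts.1 hc
  exact crossTimes_nonempty hs hs' ((isRight_of_col (ω := fun t => p.1 + p.2 t) (n := n)).1 (by omega))
    ((isRight_of_col (ω := fun t => p.1 + p.2 t) (n := n)).2 hsc')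

end StripInsertion

/-! ### The insertion `Ψ` and its cost, over `stripPairs` / `triCuts` (faces hcost/hmem/hinj of the door) -/

section Insertion

open StripInsertion

variable {T n : ℕ}

/-- **The four-column slab insertion `Ψ`** of the door «TRI-STRIP-STRICT»: for a pair `p = (a, υ) ∈ stripPairs T n`
and a set `R` of admissible cuts of the placed walk `t ↦ a + υ t`, the pair `(a, Ψ)` of the same start and the
translate of the image walk. [cite: MadrasSlade1993, §8.2, Theorem 8.2.1 (8.2.13), p. 269 (statement; slab insertion = the lane's proof)] -/
def stripInsertion (T n : ℕ) (p : Site 2 × (ℕ → Site 2)) (R : Finset ℤ) : Site 2 × (ℕ → Site 2) :=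
  (p.1, psi T R (fun t => p.1 + p.2 t) n)

/-- **The cost of a cut** under the insertion: the extra length of the image contributed by its crossings.
[cite: MadrasSlade1993, §8.2, Theorem 8.2.1 (8.2.13), p. 269 (statement; slab insertion = the lane's proof)] -/
def stripInsertionCost (T n : ℕ) (p : Site 2 × (ℕ → Site 2)) (c : ℤ) : ℕ :=
  cost T (fun t => p.1 + p.2 t) n c

/-- The insertion keeps the starting site. [cite: MadrasSlade1993, §8.2, Theorem 8.2.1 (8.2.13), p. 269] -/
@[simp] theorem stripInsertion_fst (T n : ℕ) (p : Site 2 × (ℕ → Site 2)) (R : Finset ℤ) :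
    (stripInsertion T n p R).1 = p.1 := rfl

/-- **(hcost) Each cut costs at most `4T + 6` extra steps.** [cite: MadrasSlade1993, §8.2, Theorem 8.2.1 (8.2.13), p. 269 (statement; slab insertion = the lane's proof)] -/
theorem stripInsertionCost_le (n : ℕ) (p : Site 2 × (ℕ → Site 2)) (hp : p ∈ stripPairs T n) (c : ℤ) :
    stripInsertionCost T n p c ≤ 4 * T + 6 :=
  cost_le (stripWalk_of_mem hp).1 c

/-- **(hmem) The image is a self-avoiding walk of the wider strip `S_{T+1}` from the same start, of length
`n + Σ_{c ∈ R} cost(c)`.** [cite: MadrasSlade1993, §8.2, Theorem 8.2.1 (8.2.13), p. 269 (statement; slab insertion = the lane's proof)] -/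
theorem stripInsertion_mem (n : ℕ) (p : Site 2 × (ℕ → Site 2)) (R : Finset ℤ) (hp : p ∈ stripPairs T n) :
    stripInsertion T n p R ∈ stripPairs (T + 1) (n + ∑ c ∈ R, stripInsertionCost T n p c) := by
  obtain ⟨hW, h0⟩ := stripWalk_of_mem hp
  obtain ⟨hs, hin⟩ := psi_spec (R := R) hW
  have hlen : (imageList T R (fun t => p.1 + p.2 t) n).length - 1 = n + ∑ c ∈ R, stripInsertionCost T n p c := by
    rw [length_imageList hW]; unfold stripInsertionCost; omega
  rw [hlen] at hs hin
  simp only [h0] at hin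
  exact mem_stripPairs.2 ⟨HexBW.stripStarts_mono (Nat.le_succ T) (mem_stripPairs.1 hp).1, hs, hin⟩

/-- **(hinj) The insertion is injective on the pairs (walk, subset of its admissible cuts).**
[cite: MadrasSlade1993, §8.2, Theorem 8.2.1 (8.2.13), p. 269 (statement; slab insertion = the lane's proof)] -/
theorem stripInsertion_injOn (T n : ℕ) :
    Set.InjOn (fun q : (Σ _ : Site 2 × (ℕ → Site 2), Finset ℤ) => stripInsertion T n q.1 q.2)
      {q | q.1 ∈ stripPairs T n ∧ q.2 ⊆ triCuts q.1.1 q.1.2 n} := by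
  rintro ⟨p, R⟩ ⟨hp, hR⟩ ⟨p', R'⟩ ⟨hp', hR'⟩ h
  dsimp only at hp hR hp' hR' h
  obtain ⟨hW, h0⟩ := stripWalk_of_mem hp
  obtain ⟨hW', h0'⟩ := stripWalk_of_mem hp'
  have h' := h
  simp only [stripInsertion, Prod.mk.injEq] at h'
  obtain ⟨ha, hψ⟩ := h'
  have hm := stripInsertion_mem n p R hp
  have hm' := stripInsertion_mem n p' R' hp'
  rw [h] at hm
  have hlen := eq_of_mem_brickSaws_of_mem (mem_stripPairs.1 hm).2.1 (mem_stripPairs.1 hm').2.1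
  have hlen' : (imageList T R (fun t => p.1 + p.2 t) n).length =
      (imageList T R' (fun t => p'.1 + p'.2 t) n).length := by
    rw [length_imageList hW, length_imageList hW']
    unfold stripInsertionCost at hlen
    omega
  have hcR : ∀ c ∈ R, (crossTimes (fun t => p.1 + p.2 t) n c).Nonempty := fun c hc =>
    crossTimes_nonempty_of_mem_triCuts (hR hc)
  have hcR' : ∀ c ∈ R', (crossTimes (fun t => p'.1 + p'.2 t) n c).Nonempty := fun c hc =>
    crossTimes_nonempty_of_mem_triCuts (hR' hc)
  obtain ⟨hRR, hω⟩ := psi_inj hW hW' (by rw [h0, h0', ha]) hcR hcR' hlen' hψ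
  have hυ : p.2 = p'.2 := by
    obtain ⟨-, he, -, -⟩ := mem_brickSaws.1 (mem_stripPairs.1 hp).2.1
    obtain ⟨-, he', -, -⟩ := mem_brickSaws.1 (mem_stripPairs.1 hp').2.1
    funext t
    rcases le_or_gt t n with ht | ht
    · have := hω t ht; rw [ha] at this; exact add_left_cancel this
    · rw [he t ht.le, he' t ht.le]
      have := hω n le_rfl; rw [ha] at this; exact add_left_cancel this
  have hpp : p = p' := Prod.ext ha hυ
  subst hpp; subst hRR; rfl

/-- **Faces hcost/hmem/hinj of the door «TRI-STRIP-STRICT», packaged**: for every width `T` the insertion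
`Ψ = stripInsertion T` with cost `stripInsertionCost T` satisfies the three hypotheses of the summation step
`TriStrip.core_of_insertion` / `TriStrip.stripConnectiveConstant_lt_succ_of_insertion`.
[cite: MadrasSlade1993, §8.2, Theorem 8.2.1 (8.2.13), p. 269 (statement; slab insertion = the lane's proof)] -/
theorem stripInsertion_hyp (T : ℕ) :
    (∀ n p, p ∈ stripPairs T n → ∀ c ∈ triCuts p.1 p.2 n, stripInsertionCost T n p c ≤ 4 * T + 6) ∧
    (∀ n p R, p ∈ stripPairs T n → R ⊆ triCuts p.1 p.2 n →
      stripInsertion T n p R ∈ stripPairs (T + 1) (n + ∑ c ∈ R, stripInsertionCost T n p c)) ∧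
    (∀ n, Set.InjOn (fun q : (Σ _ : Site 2 × (ℕ → Site 2), Finset ℤ) => stripInsertion T n q.1 q.2)
      {q | q.1 ∈ stripPairs T n ∧ q.2 ⊆ triCuts q.1.1 q.1.2 n}) :=
  ⟨fun n p hp c _ => stripInsertionCost_le n p hp c, fun n p R hp _ => stripInsertion_mem n p R hp,
    fun n => stripInsertion_injOn T n⟩

end Insertion

end Literature.Probability.RandomPlanarGeometry.SAW.TriStrip
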